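import Summits.ResolutionOfSingularities.ResolutionOfSingularities.Theorems.EquisingularLiftEquisingularLiftNatOpeningPointPhase
import Summits.ResolutionOfSingularities.ResolutionOfSingularities.Theorems.EquisingularLiftEquisingularLiftNatHostedRoundSeam
import Summits.ResolutionOfSingularities.ResolutionOfSingularities.Theorems.EquisingularLiftEquisingularLiftNatBoundaryWitnessedCentre
import Summits.ResolutionOfSingularities.ResolutionOfSingularities.Theorems.EquisingularLiftEquisingularLiftNatPreLetterCurveRound
import Summits.ResolutionOfSingularities.ResolutionOfSingularities.Theorems.EquisingularLiftEquisingularLiftNatLetterPromotion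
import Summits.ResolutionOfSingularities.ResolutionOfSingularities.Theorems.EquisingularLiftEquisingularLiftNatExceptionalReducedModel
import Summits.ResolutionOfSingularities.ResolutionOfSingularities.Theorems.EquisingularLiftEquisingularLiftNatNDLeafPointPackage
import Summits.ResolutionOfSingularities.ResolutionOfSingularities.Theorems.EquisingularLiftEquisingularLiftNatResidueHypDefs8
import Literature.AlgebraicGeometry.Resolution.SNCStrataSmooth
import Summits.ResolutionOfSingularities.ResolutionOfSingularities.Theorems.EquisingularLiftEquisingularLiftNatKeyLetterIncidence
import HarnessLib

/-!
# [OURS · L1 W4.5(b) · EL♮(3) · WIDTH TABLE D5 «IMMATURE HOST», supplier row HOPEN, part 2, v2] THE CERTIFIED-OPENING SUPPLIER OF THE K5⁶ ENGINE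
# `TCPlus.hopen_supplier_of₂ k H ι hBirth hG1P hG1C hCLw : <HOPEN of ✓ target_elnat_of_letteredPrefixResolution at n := 3, Open := OpeningCertKeyLetter k 3 H ι>`

res-L1-w45b-stub-2 g16 (desk R54 «HOPEN assembly = stub-2»; split of record l.83769).  OURS; NOT a statement of any manuscript ([Hironaka2017] is a candidate
under adjudication, nothing of it is asserted); AI-written, weaker than expert review.  No `sorry`; standard axioms; DEF-FREE; FOUR lemma-shaped ∀-hypotheses
(ordinary theorems landed by their own files): (IN-1) `hBirth` joint birth at `ℙ³_O` (res-type-027), (IN-2) `hG1P` / (IN-3) `hG1C` the G1 incidence rules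
through the point step / the CAR round (res-L1-w45b-stub-4, instances of ✓ `…NatKeyLetterIncidence`), (IN-4) `hCLw` the crossed letter with its model
(res-L1-w45b-stub-4 `TCPlus.crossedLetter_clauses`, re-spelt `TCPlus.crossedLetter_clauses'`).  `--supports stmt-ResolutionOfSingularities-20148 --as helper`.
SUPERSEDES ✓ `TCPlus.hopen_supplier_of` (…NatOpeningSupplier, p673006; same proof): there (IN-3) quantified over an ARBITRARY `jG : G ⟶ X` with trace
`𝒞.comap jG = 𝓘⟨Z⟩` and is not instantiable (res-L1-w45b-stub-4: a closed point `jG` off `supp 𝒞` makes it fail); here (IN-3) carries the MODEL SQUARE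
(`θ` surjective, `tG`, `IsPullback jG tG (σ ≫ q) (Spec.map θ)`, `[IsProper (σ ≫ q)]`) — res-L1-w45b-stub-4's `TCPlus.keyInc_carrierRound_of_order`.

WHAT.  For every position certified by ✓ `OpeningCertKeyLetter` (Defs8 ✓ p671016): the point phase is part 1 ✓ `TCPlus.opening_pointPhase`; then the CAR
round at the carrier `Z = E ∩ St Π`: centre `𝓢 ⊔ St 𝓛_Π` regular and `O`-flat by res-L1-w45b-lead-1's ✓ pair lemmas ((A4) transversality, curve clause,
T-DIM), E1-legality, `Bl` and its model square by ✓ `modelStep_chain`, 2-frames by ✓ `hFrame_of_ringKrullDim_redSub`; the members `St E`, `St² Π` by ✓ HT2′;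
the immature key letter through the round by ✓ Δ2b at `a' = 1` (`hord` from (IN-2)'s incidence, `hcodim` DERIVED from the curve clause via
✓ `ND.goodAt_and_dim_of_model` + T-DIM); its TAG `St²𝓜 ≤ 𝓔₁ ⊔ St² 𝓛_Λ` by (IN-3); the face/other letters by (IN-4); the exceptional letter `E₁` born with
`𝒞·𝒪` (res-D-pv-029's ✓ `comap_comap_eq_vanishingIdeal_preimage_of_model`, Liu 8.1.19); PROMOTION of `St² M` with the model kept (✓ p665751's argument);
and the output slots of the certificate (`T₃`, `Ls₃ ⊆ …`, the tag `(St²M; E₁, St²Λ)`). [folklore; pure composition of the cited tree theorems]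
-/

set_option linter.dupNamespace false
set_option linter.overlappingInstances false

noncomputable section

open CategoryTheory CategoryTheory.Limits AlgebraicGeometry TopologicalSpace Topology IsLocalRing MvPolynomial
open Literature.AlgebraicGeometry.Motives (projectiveSpace)
open Literature.AlgebraicGeometry.Resolution AlgebraicGeometry.Scheme.IdealSheafData
open Summit.ResolutionOfSingularities.ResolutionOfSingularities.Theses.EquisingularLift.Split
open Summit.ResolutionOfSingularities.ResolutionOfSingularities.Cruxes.EquisingularLift.StrataSplit

namespace Summit.ResolutionOfSingularities.ResolutionOfSingularities.Cruxes.EquisingularLiftNat.Sections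

/-- Cancellation in `WithBot ℕ∞`: `a + 1 = d + 1 ⇒ a = d` for natural `d`. [elementary] -/
private theorem withBot_enat_succ_cancel {a : WithBot ℕ∞} {d : ℕ} (h : a + 1 = ((d + 1 : ℕ) : WithBot ℕ∞)) : a = (d : WithBot ℕ∞) := by
  induction a using WithBot.recBotCoe with
  | bot => rw [WithBot.bot_add, ← WithBot.coe_natCast] at h; exact (WithBot.bot_ne_coe h).elim
  | coe b =>
    have h2 : ((b : WithBot ℕ∞) + 1) = ((b + 1 : ℕ∞) : WithBot ℕ∞) := by push_cast; rfl
    rw [h2, ← WithBot.coe_natCast, WithBot.coe_inj] at h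
    rw [← WithBot.coe_natCast]; congr 1
    induction b using ENat.recTopCoe with
    | top => exfalso; rw [top_add] at h; exact (ENat.top_ne_coe _ h).elim
    | coe m =>
      have h' : ((m + 1 : ℕ) : ℕ∞) = ((d + 1 : ℕ) : ℕ∞) := by push_cast at h ⊢; exact h
      have hm : m = d := by have := Nat.cast_injective (R := ℕ∞) h'; omega
      subst hm; rfl

set_option maxHeartbeats 1600000 in
/-- **HOPEN — the certified-opening supplier of the K5⁶ engine at `n = 3`, `Open := OpeningCertKeyLetter k 3 H ι`**, modulo (IN-1) joint birth,
(IN-2) G1-P, (IN-3) G1-CAR and (IN-4) the crossed letter with its model (see the module docstring). [folklore; pure composition]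
[OURS · L1 W4.5b · WIDTH TABLE D5, supplier row HOPEN part 2] -/
theorem TCPlus.hopen_supplier_of₂ (k : Type) [Field k] [IsAlgClosed k] (H : Scheme.{0}) (ι : H ⟶ (projectiveSpace 3 k).left) [IsIntegral H] [IsClosedImmersion ι]
    (hBirth : (∀ (O : Type) [CommRing O] [IsDomain O] [IsDiscreteValuationRing O] [IsAdicComplete (IsLocalRing.maximalIdeal O) O] [IsAlgClosed (IsLocalRing.ResidueField O)]
        (θ : O →+* k), Function.Surjective θ → (letI := MvPolynomial.gradedAlgebra (σ := Fin (3 + 1)) (R := O); letI := MvPolynomial.gradedAlgebra (σ := Fin (3 + 1)) (R := k);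
      ∀ (φ : homogeneousSubmodule (Fin (3 + 1)) O →+*ᵍ homogeneousSubmodule (Fin (3 + 1)) k)
        (hφ' : HomogeneousIdeal.irrelevant (homogeneousSubmodule (Fin (3 + 1)) k) ≤ (HomogeneousIdeal.irrelevant (homogeneousSubmodule (Fin (3 + 1)) O)).map φ),
        (∀ s, φ s = MvPolynomial.map θ s) →
      ∀ (s : Spec (.of O) ⟶ (Proj (homogeneousSubmodule (Fin (3 + 1)) O))), s ≫ (Proj.toSpecZero (homogeneousSubmodule (Fin (3 + 1)) O) ≫ Spec.map (CommRingCat.ofHom (algebraMap O (homogeneousSubmodule (Fin (3 + 1)) O 0)))) = 𝟙 _ →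
      ∀ (x₀ : (projectiveSpace 3 k).left), s (IsLocalRing.closedPoint O) = (Proj.map φ hφ' : (projectiveSpace 3 k).left ⟶ Proj (homogeneousSubmodule (Fin (3 + 1)) O)) x₀ →
      ∀ (ℓh ℓj : MvPolynomial (Fin (3 + 1)) k) (ℓs : List (MvPolynomial (Fin (3 + 1)) k)) (G U R₁ R₂ : MvPolynomial (Fin (3 + 1)) k) (e a : ℕ),
        (∀ ℓ ∈ ℓh :: ℓj :: ℓs, ℓ.IsHomogeneous 1 ∧ ℓ ≠ 0 ∧ x₀ ∈ {y : (projectiveSpace 3 k).left | ℓ ∈ (y : ProjectiveSpectrum (homogeneousSubmodule (Fin (3 + 1)) k)).asHomogeneousIdeal} ∧ ¬ (Set.range ι ⊆ {y : (projectiveSpace 3 k).left | ℓ ∈ (y : ProjectiveSpectrum (homogeneousSubmodule (Fin (3 + 1)) k)).asHomogeneousIdeal})) →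
        G.IsHomogeneous e → 2 ≤ a → G = ℓh ^ a * U + ℓh * R₁ + R₂ * ℓj → R₁ ∈ ((x₀ : ProjectiveSpectrum (homogeneousSubmodule (Fin (3 + 1)) k)).asHomogeneousIdeal).toIdeal ^ a → R₂ ∈ ((x₀ : ProjectiveSpectrum (homogeneousSubmodule (Fin (3 + 1)) k)).asHomogeneousIdeal).toIdeal ^ a → U ∉ ((x₀ : ProjectiveSpectrum (homogeneousSubmodule (Fin (3 + 1)) k)).asHomogeneousIdeal) →
        ¬ (Set.range ι ⊆ {y : (projectiveSpace 3 k).left | G ∈ (y : ProjectiveSpectrum (homogeneousSubmodule (Fin (3 + 1)) k)).asHomogeneousIdeal}) → (∀ i : Fin (3 + 1), (Ideal.span {MvPolynomial.aeval (Function.update MvPolynomial.X i (1 : MvPolynomial (Fin (3 + 1)) k)) G}).IsRadical) →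
        ∃ (𝓛 : MvPolynomial (Fin (3 + 1)) k → ((Proj (homogeneousSubmodule (Fin (3 + 1)) O))).IdealSheafData) (𝓜 : ((Proj (homogeneousSubmodule (Fin (3 + 1)) O))).IdealSheafData) (Gst : ((Proj (homogeneousSubmodule (Fin (3 + 1)) O))).presheaf.stalk ((Proj.map φ hφ' : (projectiveSpace 3 k).left ⟶ Proj (homogeneousSubmodule (Fin (3 + 1)) O)) x₀)),
          (∀ ℓ ∈ ℓh :: ℓj :: ℓs, ((𝓛 ℓ).comap (Proj.map φ hφ' : (projectiveSpace 3 k).left ⟶ Proj (homogeneousSubmodule (Fin (3 + 1)) O)) = vanishingIdeal (⟨closure {y : (projectiveSpace 3 k).left | ℓ ∈ (y : ProjectiveSpectrum (homogeneousSubmodule (Fin (3 + 1)) k)).asHomogeneousIdeal}, isClosed_closure⟩ : Closeds (projectiveSpace 3 k).left) ∧ (∀ z : ↥(Proj (homogeneousSubmodule (Fin (3 + 1)) O)), (stalkIdeal (𝓛 ℓ) z).IsPrincipal) ∧ Scheme.IsRegular (𝓛 ℓ).subscheme ∧ (𝟙 (Proj (homogeneousSubmodule (Fin (3 + 1)) O))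 : _ ⟶ _) '' ((𝓛 ℓ).support : Set ↥(Proj (homogeneousSubmodule (Fin (3 + 1)) O))) ⊆ {y : ↥(Proj (homogeneousSubmodule (Fin (3 + 1)) O)) | ¬ IsGenericPoint y (Set.range (ι ≫ Proj.map φ hφ' : H ⟶ Proj (homogeneousSubmodule (Fin (3 + 1)) O)))} ∧ Flat ((𝓛 ℓ).subschemeι ≫ 𝟙 (Proj (homogeneousSubmodule (Fin (3 + 1)) O)) ≫ (Proj.toSpecZero (homogeneousSubmodule (Fin (3 + 1)) O) ≫ Spec.map (CommRingCat.ofHom (algebraMap O (homogeneousSubmodule (Fin (3 + 1)) O 0)))))) ∧ 𝓛 ℓ ≤ s.ker) ∧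
          ((𝓜).comap (Proj.map φ hφ' : (projectiveSpace 3 k).left ⟶ Proj (homogeneousSubmodule (Fin (3 + 1)) O)) = vanishingIdeal (⟨closure {y : (projectiveSpace 3 k).left | G ∈ (y : ProjectiveSpectrum (homogeneousSubmodule (Fin (3 + 1)) k)).asHomogeneousIdeal}, isClosed_closure⟩ : Closeds (projectiveSpace 3 k).left) ∧ (∀ z : ↥(Proj (homogeneousSubmodule (Fin (3 + 1)) O)), (stalkIdeal (𝓜) z).IsPrincipal) ∧ (𝟙 (Proj (homogeneousSubmodule (Fin (3 + 1)) O)) : _ ⟶ _) '' ((𝓜).support : Set ↥(Proj (homogeneousSubmodule (Fin (3 + 1)) O))) ⊆ {y : ↥(Proj (homogeneousSubmodule (Fin (3 + 1)) O)) | ¬ IsGenericPoint y (Set.range (ι ≫ Proj.map φ hφ' : H ⟶ Proj (homogeneousSubmodule (Fin (3 + 1)) O)))} ∧ Flat ((𝓜).subschemeι ≫ 𝟙 (Proj (homogeneousSubmodule (Fin (3 + 1)) O)) ≫ (Proj.toSpecZero (homogeneousSubmodule (Fin (3 + 1)) O) ≫ Spec.map (CommRingCat.ofHom (algebraMap O (homogeneousSubmodule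 (Fin (3 + 1)) O 0)))))) ∧ 𝓜 ≠ ⊥ ∧
          𝓜 ≤ (𝓛 ℓh) ^ a ⊔ 𝓛 ℓh * s.ker ^ a ⊔ s.ker ^ a * 𝓛 ℓj ∧
          stalkIdeal 𝓜 ((Proj.map φ hφ' : (projectiveSpace 3 k).left ⟶ Proj (homogeneousSubmodule (Fin (3 + 1)) O)) x₀) = Ideal.span {Gst} ∧ Gst ∈ stalkIdeal s.ker ((Proj.map φ hφ' : (projectiveSpace 3 k).left ⟶ Proj (homogeneousSubmodule (Fin (3 + 1)) O)) x₀) ^ a ∧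
          ((Proj.map φ hφ' : (projectiveSpace 3 k).left ⟶ Proj (homogeneousSubmodule (Fin (3 + 1)) O)).stalkMap x₀).hom Gst ∉ IsLocalRing.maximalIdeal (((projectiveSpace 3 k).left).presheaf.stalk x₀) ^ (a + 1))))
    (hG1P : (∀ (O : Type) [CommRing O] [IsDomain O] [IsDiscreteValuationRing O] {X' X₁ : Scheme.{0}} [IsIntegral X'] [IsLocallyNoetherian X'] [IsLocallyNoetherian X₁],
        Scheme.IsRegular X' → ∀ (r' : X' ⟶ Spec (.of O)) [IsSeparated r'] (s : Spec (.of O) ⟶ X'), s ≫ r' = 𝟙 _ →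
        ∀ (τ : X₁ ⟶ X'), IsBlowup τ s.ker →
        -- two letters through the section (regular principal models containing it) and the immature key letter of exact order `a` at the section's closed point
        ∀ (𝓛h 𝓛j 𝓜 : X'.IdealSheafData) (a : ℕ) (x' : X'), s (IsLocalRing.closedPoint O) = x' → 𝓛h ≤ s.ker → 𝓛j ≤ s.ker →
          Scheme.IsRegular 𝓛h.subscheme → (∀ z : X', (stalkIdeal 𝓛h z).IsPrincipal) → Scheme.IsRegular 𝓛j.subscheme → (∀ z : X', (stalkIdeal 𝓛j z).IsPrincipal) →
          (∀ z : X', (stalkIdeal 𝓜 z).IsPrincipal) → 𝓜 ≠ ⊥ →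
          (∃ Gst : X'.presheaf.stalk x', stalkIdeal 𝓜 x' = Ideal.span {Gst} ∧ Gst ∈ stalkIdeal s.ker x' ^ a ∧ Gst ∉ IsLocalRing.maximalIdeal (X'.presheaf.stalk x') ^ (a + 1)) →
          𝓜 ≤ 𝓛h ^ a ⊔ 𝓛h * s.ker ^ a ⊔ s.ker ^ a * 𝓛j →
          strictTransformIdeal τ s.ker 𝓜 ≤ strictTransformIdeal τ s.ker 𝓛h ^ a ⊔ strictTransformIdeal τ s.ker 𝓛h * s.ker.comap τ ⊔ s.ker.comap τ * strictTransformIdeal τ s.ker 𝓛j))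
    (hG1C : (∀ (O : Type) [CommRing O] [IsDomain O] [IsDiscreteValuationRing O] (θ : O →+* k), Function.Surjective θ → ∀ {P X X₂ G G₂ : Scheme.{0}} (σ : X ⟶ P) (Y : Set P)
        (q : P ⟶ Spec (.of O)) [IsLocallyNoetherian X] [IsIntegral X] [IsLocallyNoetherian X₂] [IsIntegral X₂] [CompactSpace X₂] [IsLocallyNoetherian G] [IsIntegral G] [IsLocallyNoetherian G₂]
        [IsIntegral G₂] [JacobsonSpace G₂] [IsProper (σ ≫ q)], Scheme.IsRegular X → ∀ (jG : G ⟶ X) (tG : G ⟶ Spec (.of k)), IsPullback jG tG (σ ≫ q) (Spec.map (CommRingCat.ofHom θ)) →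
        -- the CAR centre `𝒞 = 𝓢 ⊔ 𝓟` (a regular relative curve with 2-frames and reduced trace `𝓘⟨Z⟩`), the round `τ = Bl_𝒞`, `υ₂ = Bl_Z`, the new square
        ∀ (𝓢 𝓟 𝓠 𝓜 : X.IdealSheafData) {Z : Set G} (hZ : IsClosed Z), (𝓢 ⊔ 𝓟).comap jG = vanishingIdeal ⟨Z, hZ⟩ → Scheme.IsRegular (𝓢 ⊔ 𝓟).subscheme → 𝓢 ⊔ 𝓟 ≠ ⊥ →
        (∀ x ∈ (𝓢 ⊔ 𝓟).support, ∃ c : Fin 2 → X.presheaf.stalk x, Ideal.span (Set.range c) = stalkIdeal (𝓢 ⊔ 𝓟) x ∧ IsQuasiRegular c) →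
        ∀ {τ : X₂ ⟶ X}, IsBlowup τ (𝓢 ⊔ 𝓟) → ∀ {υ₂ : G₂ ⟶ G}, IsBlowup υ₂ (vanishingIdeal ⟨Z, hZ⟩) → ∀ (j₂ : G₂ ⟶ X₂), j₂ ≫ τ = υ₂ ≫ jG →
        (∀ z : ↥(vanishingIdeal (⟨Z, hZ⟩ : Closeds G)).subscheme, IsRegularLocalRing ((vanishingIdeal (⟨Z, hZ⟩ : Closeds G)).subscheme.presheaf.stalk z)) →
        (∀ z ∈ Z, IsClosed ({z} : Set G) → IsRegularLocalRing (G.presheaf.stalk z)) →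
        (∀ z ∈ Z, IsClosed ({z} : Set G) → ringKrullDim (G.presheaf.stalk z ⧸ stalkIdeal (vanishingIdeal (⟨Z, hZ⟩ : Closeds G)) z) + 2 = ringKrullDim (G.presheaf.stalk z)) →
        -- the immature key letter: principal, trace `𝓘⟨M⟩`, generic ORDER ONE along `Z`, and the G1-P membership with `2 ≤ a`
        (∀ z : X, (stalkIdeal 𝓜 z).IsPrincipal) → 𝓜 ≠ ⊥ → ∀ (M : Set G) (hM : IsClosed M), 𝓜.comap jG = vanishingIdeal ⟨M, hM⟩ →
        (∀ z ∈ Z, IsClosed ({z} : Set G) → ¬ stalkIdeal (𝓜.comap jG) z ≤ stalkIdeal (vanishingIdeal (⟨Z, hZ⟩ : Closeds G)) z ^ 2) →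
        ∀ (a : ℕ), 2 ≤ a → 𝓜 ≤ 𝓟 ^ a ⊔ 𝓟 * 𝓢 ⊔ 𝓢 * 𝓠 →
        strictTransformIdeal τ (𝓢 ⊔ 𝓟) 𝓜 ≤ (𝓢 ⊔ 𝓟).comap τ ⊔ strictTransformIdeal τ (𝓢 ⊔ 𝓟) 𝓠))
    (hCLw : ∀ (O : Type) [CommRing O] [IsDomain O] [IsDiscreteValuationRing O] (θ : O →+* k), Function.Surjective θ → ∀ {P X X₂ G G₂ : AlgebraicGeometry.Scheme.{0}} (q : P ⟶ AlgebraicGeometry.Spec (.of O)) (Y : Set P) (σ : X ⟶ P)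
        [IsLocallyNoetherian X] [AlgebraicGeometry.IsIntegral X] [IsLocallyNoetherian X₂] [AlgebraicGeometry.IsIntegral X₂]
        [IsLocallyNoetherian G] [AlgebraicGeometry.IsIntegral G] [IsLocallyNoetherian G₂] [AlgebraicGeometry.IsIntegral G₂] [AlgebraicGeometry.IsProper (σ ≫ q)],
        Literature.AlgebraicGeometry.Resolution.Scheme.IsRegular X → Literature.AlgebraicGeometry.Resolution.Scheme.IsRegular X₂ →
      ∀ (jG : G ⟶ X) (tG : G ⟶ AlgebraicGeometry.Spec (.of k)), IsPullback jG tG (σ ≫ q) (AlgebraicGeometry.Spec.map (CommRingCat.ofHom θ)) →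
      -- the centre: a regular `O`-flat relative curve with reduced trace `𝓘⟨Z⟩`, 2-frames, off `Y`; downstairs `Z̃` regular, a curve, `G` regular along `Z`
      ∀ (C : X.IdealSheafData) (Z : Set G) (hZ : IsClosed Z), C.comap jG = AlgebraicGeometry.Scheme.IdealSheafData.vanishingIdeal (⟨Z, hZ⟩ : TopologicalSpace.Closeds G) → AlgebraicGeometry.Flat (C.subschemeι ≫ σ ≫ q) →
        Literature.AlgebraicGeometry.Resolution.Scheme.IsRegular C.subscheme → C ≠ ⊥ →
        (∀ x ∈ C.support, ∃ c : Fin 2 → X.presheaf.stalk x, Ideal.span (Set.range c) = Literature.AlgebraicGeometry.Resolution.stalkIdeal C x ∧ IsQuasiRegular c) →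
        σ '' (C.support : Set X) ⊆ {p : P | ¬ IsGenericPoint p Y} →
        (∀ z : ↥(redSub G Z hZ), IsRegularLocalRing ((redSub G Z hZ).presheaf.stalk z)) →
        (∀ z : ↥(redSub G Z hZ), IsClosed ({z} : Set ↥(redSub G Z hZ)) → ringKrullDim ((redSub G Z hZ).presheaf.stalk z) = ((1 : ℕ) : WithBot ℕ∞)) →
        (∀ z ∈ Z, IsClosed ({z} : Set G) → IsRegularLocalRing (G.presheaf.stalk z)) →
      -- the round upstairs and downstairs, the new model square
      ∀ {τ : X₂ ⟶ X}, Literature.AlgebraicGeometry.Resolution.IsBlowup τ C →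
      ∀ {υ₂ : G₂ ⟶ G}, Literature.AlgebraicGeometry.Resolution.IsBlowup υ₂ (AlgebraicGeometry.Scheme.IdealSheafData.vanishingIdeal (⟨Z, hZ⟩ : TopologicalSpace.Closeds G)) →
      ∀ (j₂ : G₂ ⟶ X₂) (t₂ : G₂ ⟶ AlgebraicGeometry.Spec (.of k)), IsPullback j₂ t₂ ((τ ≫ σ) ≫ q) (AlgebraicGeometry.Spec.map (CommRingCat.ofHom θ)) → j₂ ≫ τ = υ₂ ≫ jG →
      -- (CL) a listed letter NOT containing the centre and meeting it transversally (possibly not at all) steps to its strict transform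
      ∀ (L : Set G) (𝓛 : X.IdealSheafData), 𝓛.comap jG = vanishingIdeal (⟨closure L, isClosed_closure⟩ : Closeds G) → (∀ z : X, (stalkIdeal 𝓛 z).IsPrincipal) →
        Scheme.IsRegular 𝓛.subscheme → σ '' (𝓛.support : Set X) ⊆ {p : P | ¬ IsGenericPoint p Y} → Flat (𝓛.subschemeι ≫ σ ≫ q) →
        AlgebraicGeometry.Scheme.IdealSheafData.vanishingIdeal (⟨closure L, isClosed_closure⟩ : TopologicalSpace.Closeds G) ⊔ AlgebraicGeometry.Scheme.IdealSheafData.vanishingIdeal (⟨Z, hZ⟩ : TopologicalSpace.Closeds G) =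
          AlgebraicGeometry.Scheme.IdealSheafData.vanishingIdeal (⟨closure L ∩ Z, isClosed_closure.inter hZ⟩ : TopologicalSpace.Closeds G) →
        (∀ z ∈ Z, IsClosed ({z} : Set G) → ¬ Literature.AlgebraicGeometry.Resolution.stalkIdeal (AlgebraicGeometry.Scheme.IdealSheafData.vanishingIdeal (⟨closure L, isClosed_closure⟩ : TopologicalSpace.Closeds G)) z ≤
            Literature.AlgebraicGeometry.Resolution.stalkIdeal (AlgebraicGeometry.Scheme.IdealSheafData.vanishingIdeal (⟨Z, hZ⟩ : TopologicalSpace.Closeds G)) z) →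
        ((strictTransformIdeal τ C 𝓛).comap j₂ = vanishingIdeal (⟨closure (closure (υ₂ ⁻¹' (closure L \ Z))), isClosed_closure⟩ : Closeds G₂) ∧
          (∀ z : X₂, (stalkIdeal (strictTransformIdeal τ C 𝓛) z).IsPrincipal) ∧ Scheme.IsRegular (strictTransformIdeal τ C 𝓛).subscheme ∧
          (τ ≫ σ) '' ((strictTransformIdeal τ C 𝓛).support : Set X₂) ⊆ {p : P | ¬ IsGenericPoint p Y} ∧ Flat ((strictTransformIdeal τ C 𝓛).subschemeι ≫ (τ ≫ σ) ≫ q))) :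
    ∀ (O : Type) [CommRing O] [IsDomain O] [IsDiscreteValuationRing O] [IsAdicComplete (IsLocalRing.maximalIdeal O) O]
        [IsAlgClosed (IsLocalRing.ResidueField O)] (θ : O →+* k), Function.Surjective θ → (letI := MvPolynomial.gradedAlgebra (σ := Fin (3 + 1)) (R := O);
       letI := MvPolynomial.gradedAlgebra (σ := Fin (3 + 1)) (R := k); ∀ (φ : MvPolynomial.homogeneousSubmodule (Fin (3 + 1)) O →+*ᵍ MvPolynomial.homogeneousSubmodule (Fin (3 + 1)) k)
        (hφ' : HomogeneousIdeal.irrelevant (MvPolynomial.homogeneousSubmodule (Fin (3 + 1)) k) ≤ (HomogeneousIdeal.irrelevant (MvPolynomial.homogeneousSubmodule (Fin (3 + 1)) O)).map φ),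
        (∀ s, φ s = MvPolynomial.map θ s) → ∀ (Ch : ∀ X' : AlgebraicGeometry.Scheme.{0}, (X' ⟶ (AlgebraicGeometry.Proj (MvPolynomial.homogeneousSubmodule (Fin (3 + 1)) O))) → Set X' → Prop),
        (∀ (X' X'' : AlgebraicGeometry.Scheme.{0}) (σ' : X' ⟶ (AlgebraicGeometry.Proj (MvPolynomial.homogeneousSubmodule (Fin (3 + 1)) O))) (S' : Set X') (C : X'.IdealSheafData) (τ : X'' ⟶ X'),
          Ch X' σ' S' → Literature.AlgebraicGeometry.Resolution.IsBlowup τ C →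
          Literature.AlgebraicGeometry.Resolution.Scheme.IsRegular C.subscheme → AlgebraicGeometry.Flat (C.subschemeι ≫ σ' ≫ (AlgebraicGeometry.Proj.toSpecZero (MvPolynomial.homogeneousSubmodule (Fin (3 + 1)) O) ≫ AlgebraicGeometry.Spec.map (CommRingCat.ofHom (algebraMap O (MvPolynomial.homogeneousSubmodule (Fin (3 + 1)) O 0))))) →
          σ' '' (C.support : Set X') ⊆ {y | ¬ IsGenericPoint y (Set.range (ι ≫ AlgebraicGeometry.Proj.map φ hφ' : H ⟶ AlgebraicGeometry.Proj (MvPolynomial.homogeneousSubmodule (Fin (3 + 1)) O)))} →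
          (C.support : Set X') ∩ (σ' ≫ (AlgebraicGeometry.Proj.toSpecZero (MvPolynomial.homogeneousSubmodule (Fin (3 + 1)) O) ≫ AlgebraicGeometry.Spec.map (CommRingCat.ofHom (algebraMap O (MvPolynomial.homogeneousSubmodule (Fin (3 + 1)) O 0))))) ⁻¹' {IsLocalRing.closedPoint O} ⊆ S' →
          Ch X'' (τ ≫ σ') (closure (τ ⁻¹' (S' \ (C.support : Set X'))))) →
        (∀ (X' : AlgebraicGeometry.Scheme.{0}) (σ' : X' ⟶ (AlgebraicGeometry.Proj (MvPolynomial.homogeneousSubmodule (Fin (3 + 1)) O))) (S' : Set X'), Ch X' σ' S' →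
          Summit.ResolutionOfSingularities.ResolutionOfSingularities.Theses.EquisingularLift.Split.Chain (AlgebraicGeometry.Proj (MvPolynomial.homogeneousSubmodule (Fin (3 + 1)) O)) (Set.range (ι ≫ AlgebraicGeometry.Proj.map φ hφ' : H ⟶ AlgebraicGeometry.Proj (MvPolynomial.homogeneousSubmodule (Fin (3 + 1)) O))) X' σ' S') →
        (Set.range (ι ≫ AlgebraicGeometry.Proj.map φ hφ' : H ⟶ AlgebraicGeometry.Proj (MvPolynomial.homogeneousSubmodule (Fin (3 + 1)) O))) ⊆ (AlgebraicGeometry.Proj.toSpecZero (MvPolynomial.homogeneousSubmodule (Fin (3 + 1)) O) ≫ AlgebraicGeometry.Spec.map (CommRingCat.ofHom (algebraMap O (MvPolynomial.homogeneousSubmodule (Fin (3 + 1)) O 0)))) ⁻¹' {IsLocalRing.closedPoint O} → IsIrreducible (Set.range (ι ≫ AlgebraicGeometry.Proj.map φ hφ' : H ⟶ AlgebraicGeometry.Proj (MvPolynomial.homogeneousSubmodule (Fin (3 + 1)) O))) → IsClosed (Set.range (ι ≫ AlgebraicGeometry.Proj.map φ hφ' : H ⟶ AlgebraicGeometry.Proj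 (MvPolynomial.homogeneousSubmodule (Fin (3 + 1)) O))) →
        AlgebraicGeometry.IsIntegral (AlgebraicGeometry.Proj (MvPolynomial.homogeneousSubmodule (Fin (3 + 1)) O)) → IsLocallyNoetherian (AlgebraicGeometry.Proj (MvPolynomial.homogeneousSubmodule (Fin (3 + 1)) O)) → Literature.AlgebraicGeometry.Resolution.Scheme.IsRegular (AlgebraicGeometry.Proj (MvPolynomial.homogeneousSubmodule (Fin (3 + 1)) O)) →
        AlgebraicGeometry.IsProper (AlgebraicGeometry.Proj.toSpecZero (MvPolynomial.homogeneousSubmodule (Fin (3 + 1)) O) ≫ AlgebraicGeometry.Spec.map (CommRingCat.ofHom (algebraMap O (MvPolynomial.homogeneousSubmodule (Fin (3 + 1)) O 0)))) → AlgebraicGeometry.SmoothOfRelativeDimension 3 (AlgebraicGeometry.Proj.toSpecZero (MvPolynomial.homogeneousSubmodule (Fin (3 + 1)) O) ≫ AlgebraicGeometry.Spec.map (CommRingCat.ofHom (algebraMap O (MvPolynomial.homogeneousSubmodule (Fin (3 + 1)) O 0)))) →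
      -- the INITIAL stage `(ℙⁿ_O, 𝟙, Y)` and its model `ℙⁿ_k` (the base model square `Proj.map φ`)
      Ch (AlgebraicGeometry.Proj (MvPolynomial.homogeneousSubmodule (Fin (3 + 1)) O)) (𝟙 (AlgebraicGeometry.Proj (MvPolynomial.homogeneousSubmodule (Fin (3 + 1)) O))) (Set.range (ι ≫ AlgebraicGeometry.Proj.map φ hφ' : H ⟶ AlgebraicGeometry.Proj (MvPolynomial.homogeneousSubmodule (Fin (3 + 1)) O))) → AlgebraicGeometry.IsDominant (𝟙 (AlgebraicGeometry.Proj (MvPolynomial.homogeneousSubmodule (Fin (3 + 1)) O)) ≫ (AlgebraicGeometry.Proj.toSpecZero (MvPolynomial.homogeneousSubmodule (Fin (3 + 1)) O) ≫ AlgebraicGeometry.Spec.map (CommRingCat.ofHom (algebraMap O (MvPolynomial.homogeneousSubmodule (Fin (3 + 1)) O 0))))) →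
      AlgebraicGeometry.IsIntegral (Literature.AlgebraicGeometry.Motives.projectiveSpace 3 k).left →
      ∀ (t : (Literature.AlgebraicGeometry.Motives.projectiveSpace 3 k).left ⟶ AlgebraicGeometry.Spec (.of k)),
        IsPullback (AlgebraicGeometry.Proj.map φ hφ' : (Literature.AlgebraicGeometry.Motives.projectiveSpace 3 k).left ⟶ AlgebraicGeometry.Proj (MvPolynomial.homogeneousSubmodule (Fin (3 + 1)) O)) t (𝟙 (AlgebraicGeometry.Proj (MvPolynomial.homogeneousSubmodule (Fin (3 + 1)) O)) ≫ (AlgebraicGeometry.Proj.toSpecZero (MvPolynomial.homogeneousSubmodule (Fin (3 + 1)) O) ≫ AlgebraicGeometry.Spec.map (CommRingCat.ofHom (algebraMap O (MvPolynomial.homogeneousSubmodule (Fin (3 + 1)) O 0))))) (AlgebraicGeometry.Spec.map (CommRingCat.ofHom θ)) →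
      IsClosed (Set.range ι) → IsIrreducible (Set.range ι) → (AlgebraicGeometry.Proj.map φ hφ' : (Literature.AlgebraicGeometry.Motives.projectiveSpace 3 k).left ⟶ AlgebraicGeometry.Proj (MvPolynomial.homogeneousSubmodule (Fin (3 + 1)) O)) '' Set.range ι = (Set.range (ι ≫ AlgebraicGeometry.Proj.map φ hφ' : H ⟶ AlgebraicGeometry.Proj (MvPolynomial.homogeneousSubmodule (Fin (3 + 1)) O))) →
      ∀ (F₃ : AlgebraicGeometry.Scheme.{0}) (ρ₃ : F₃ ⟶ (Literature.AlgebraicGeometry.Motives.projectiveSpace 3 k).left) (T₃ : Set F₃) (Ls₃ : List (Set F₃)) (Kp₃ : Option (Set F₃ × Set F₃ × Set F₃)), OpeningCertKeyLetter k 3 H ι F₃ ρ₃ T₃ Ls₃ Kp₃ →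
        ∃ (X₉ : AlgebraicGeometry.Scheme.{0}) (σ₉ : X₉ ⟶ (AlgebraicGeometry.Proj (MvPolynomial.homogeneousSubmodule (Fin (3 + 1)) O))) (S₉ : Set X₉) (j₉ : F₃ ⟶ X₉)
          (t₉ : F₃ ⟶ AlgebraicGeometry.Spec (.of k)), Ch X₉ σ₉ S₉ ∧ AlgebraicGeometry.IsIntegral X₉ ∧ IsLocallyNoetherian X₉ ∧
          Literature.AlgebraicGeometry.Resolution.Scheme.IsRegular X₉ ∧ AlgebraicGeometry.IsDominant (σ₉ ≫ (AlgebraicGeometry.Proj.toSpecZero (MvPolynomial.homogeneousSubmodule (Fin (3 + 1)) O) ≫ AlgebraicGeometry.Spec.map (CommRingCat.ofHom (algebraMap O (MvPolynomial.homogeneousSubmodule (Fin (3 + 1)) O 0))))) ∧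
          IsPullback j₉ t₉ (σ₉ ≫ (AlgebraicGeometry.Proj.toSpecZero (MvPolynomial.homogeneousSubmodule (Fin (3 + 1)) O) ≫ AlgebraicGeometry.Spec.map (CommRingCat.ofHom (algebraMap O (MvPolynomial.homogeneousSubmodule (Fin (3 + 1)) O 0))))) (AlgebraicGeometry.Spec.map (CommRingCat.ofHom θ)) ∧ j₉ '' T₃ = S₉ ∧
          IsClosed T₃ ∧ IsIrreducible T₃ ∧ AlgebraicGeometry.IsIntegral F₃ ∧
          (∀ L ∈ Ls₃, TCPlus.LetterDatum O (AlgebraicGeometry.Proj (MvPolynomial.homogeneousSubmodule (Fin (3 + 1)) O)) (AlgebraicGeometry.Proj.toSpecZero (MvPolynomial.homogeneousSubmodule (Fin (3 + 1)) O) ≫ AlgebraicGeometry.Spec.map (CommRingCat.ofHom (algebraMap O (MvPolynomial.homogeneousSubmodule (Fin (3 + 1)) O 0)))) (Set.range (ι ≫ AlgebraicGeometry.Proj.map φ hφ' : H ⟶ AlgebraicGeometry.Proj (MvPolynomial.homogeneousSubmodule (Fin (3 + 1)) O))) F₃ X₉ σ₉ j₉ L) ∧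
          (∀ K A C : Set F₃, Kp₃ = some (K, A, C) → (∃ (𝓚 𝓐 𝓒 : X₉.IdealSheafData), (𝓚.comap j₉ = AlgebraicGeometry.Scheme.IdealSheafData.vanishingIdeal (⟨closure K, isClosed_closure⟩ : TopologicalSpace.Closeds F₃) ∧ (∀ z : X₉, (Literature.AlgebraicGeometry.Resolution.stalkIdeal 𝓚 z).IsPrincipal) ∧ Literature.AlgebraicGeometry.Resolution.Scheme.IsRegular 𝓚.subscheme ∧ σ₉ '' (𝓚.support : Set X₉) ⊆ {y : ↥(AlgebraicGeometry.Proj (MvPolynomial.homogeneousSubmodule (Fin (3 + 1)) O)) | ¬ IsGenericPoint y (Set.range (ι ≫ AlgebraicGeometry.Proj.map φ hφ' : H ⟶ AlgebraicGeometry.Proj (MvPolynomial.homogeneousSubmodule (Fin (3 + 1)) O)))} ∧ AlgebraicGeometry.Flat (𝓚.subschemeι ≫ σ₉ ≫ (AlgebraicGeometry.Proj.toSpecZero (MvPolynomial.homogeneousSubmodule (Fin (3 + 1)) O) ≫ AlgebraicGeometry.Spec.map (CommRingCat.ofHom (algebraMap O (MvPolynomial.homogeneousSubmodule (Fin (3 +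 1)) O 0)))))) ∧
            (𝓐.comap j₉ = AlgebraicGeometry.Scheme.IdealSheafData.vanishingIdeal (⟨closure A, isClosed_closure⟩ : TopologicalSpace.Closeds F₃) ∧ (∀ z : X₉, (Literature.AlgebraicGeometry.Resolution.stalkIdeal 𝓐 z).IsPrincipal) ∧ Literature.AlgebraicGeometry.Resolution.Scheme.IsRegular 𝓐.subscheme ∧ σ₉ '' (𝓐.support : Set X₉) ⊆ {y : ↥(AlgebraicGeometry.Proj (MvPolynomial.homogeneousSubmodule (Fin (3 + 1)) O)) | ¬ IsGenericPoint y (Set.range (ι ≫ AlgebraicGeometry.Proj.map φ hφ' : H ⟶ AlgebraicGeometry.Proj (MvPolynomial.homogeneousSubmodule (Fin (3 + 1)) O)))} ∧ AlgebraicGeometry.Flat (𝓐.subschemeι ≫ σ₉ ≫ (AlgebraicGeometry.Proj.toSpecZero (MvPolynomial.homogeneousSubmodule (Fin (3 + 1)) O) ≫ AlgebraicGeometry.Spec.map (CommRingCat.ofHom (algebraMap O (MvPolynomial.homogeneousSubmodule (Fin (3 + 1)) O 0)))))) ∧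
            (𝓒.comap j₉ = AlgebraicGeometry.Scheme.IdealSheafData.vanishingIdeal (⟨closure C, isClosed_closure⟩ : TopologicalSpace.Closeds F₃) ∧ (∀ z : X₉, (Literature.AlgebraicGeometry.Resolution.stalkIdeal 𝓒 z).IsPrincipal) ∧ Literature.AlgebraicGeometry.Resolution.Scheme.IsRegular 𝓒.subscheme ∧ σ₉ '' (𝓒.support : Set X₉) ⊆ {y : ↥(AlgebraicGeometry.Proj (MvPolynomial.homogeneousSubmodule (Fin (3 + 1)) O)) | ¬ IsGenericPoint y (Set.range (ι ≫ AlgebraicGeometry.Proj.map φ hφ' : H ⟶ AlgebraicGeometry.Proj (MvPolynomial.homogeneousSubmodule (Fin (3 + 1)) O)))} ∧ AlgebraicGeometry.Flat (𝓒.subschemeι ≫ σ₉ ≫ (AlgebraicGeometry.Proj.toSpecZero (MvPolynomial.homogeneousSubmodule (Fin (3 + 1)) O) ≫ AlgebraicGeometry.Spec.map (CommRingCat.ofHom (algebraMap O (MvPolynomial.homogeneousSubmodule (Fin (3 + 1)) O 0)))))) ∧ 𝓚 ≤ 𝓐 ⊔ 𝓒))) := by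
  intro O _ _ _ _ _ θ hθ φ hφ' hφ Ch hChStep hChSplit hYsp hYirr hYcl hPint hPnoeth hPreg hqprop hqsm hCh₀ hdom₀ hF₁k t hsq₀ hT₁cl hirr hTS
    F₃ ρ₃ T₃ Ls₃ Kp₃ hOpen
  classical
  letI := MvPolynomial.gradedAlgebra (σ := Fin (3 + 1)) (R := O)
  letI := MvPolynomial.gradedAlgebra (σ := Fin (3 + 1)) (R := k)
  obtain ⟨F₂, x₀, υ, hx₀, ℓh, ℓj, ℓs, G, U, R₁, R₂, e, a, υ', hZ, hxreg, hletters, hGe, ha, hGeq, hR₁, hR₂, hU, hHG, hrad, hFreg, hυ, hZT, hTZ, -, hZdim, hZreg, hFZreg, hW1, hgen, hothers, hυ', hprom, hρ₃, hT₃, hLs₃, -, hKp₃⟩ := hOpen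
  subst hρ₃ hT₃ hKp₃
  haveI := hPint; haveI := hPnoeth; haveI := hqprop; haveI := hqsm; haveI := hF₁k
  -- PART 1: the point phase with every model explicit
  obtain ⟨s, X₁, τ, j₂, t₂, 𝓛, 𝓜, hF₂, hT₂irr, hs, hss₀, hsoff, hτ, hcomm, hE, hCh₁, hint₁, hnoeth₁, hreg₁, hdom₁, hsq₂, ⟨he1, he2, he3, he4, he5⟩, hLt, ⟨hS1, hS2, hS4, hS5, hS0⟩, hincS⟩ :=
    TCPlus.opening_pointPhase k H ι hBirth hG1P O θ hθ φ hφ' hφ Ch hChStep hChSplit hYsp hYirr hYcl hPint hPnoeth hPreg hqprop hqsm hCh₀ hdom₀ hF₁k t hsq₀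
      hT₁cl hirr hTS x₀ hx₀ hxreg hFreg F₂ υ hυ ℓh ℓj ℓs G U R₁ R₂ e a hletters hGe ha hGeq hR₁ hR₂ hU hHG hrad
  haveI := hF₂; haveI := hint₁; haveI := hnoeth₁; haveI := hdom₁
  have hch₁ : Chain _ (Set.range (ι ≫ Proj.map φ hφ' : H ⟶ Proj (homogeneousSubmodule (Fin (3 + 1)) O))) X₁ (τ ≫ 𝟙 (Proj (homogeneousSubmodule (Fin (3 + 1)) O))) (j₂ '' closure (υ ⁻¹' (Set.range ι \ {((vanishingIdeal (⟨closure (Set.range ι), isClosed_closure⟩ : Closeds (projectiveSpace 3 k).left)).subschemeι x₀ : (projectiveSpace 3 k).left)}))) := hChSplit _ _ _ hCh₁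
  obtain ⟨-, -, hσ₁prop⟩ := chain_isRegular _ (Set.range (ι ≫ Proj.map φ hφ' : H ⟶ Proj (homogeneousSubmodule (Fin (3 + 1)) O))) X₁ (τ ≫ 𝟙 (Proj (homogeneousSubmodule (Fin (3 + 1)) O))) (j₂ '' closure (υ ⁻¹' (Set.range ι \ {((vanishingIdeal (⟨closure (Set.range ι), isClosed_closure⟩ : Closeds (projectiveSpace 3 k).left)).subschemeι x₀ : (projectiveSpace 3 k).left)}))) hch₁ hPnoeth hPreg
  haveI := hσ₁prop
  haveI : IsProper ((τ ≫ 𝟙 (Proj (homogeneousSubmodule (Fin (3 + 1)) O))) ≫ (Proj.toSpecZero (homogeneousSubmodule (Fin (3 + 1)) O) ≫ Spec.map (CommRingCat.ofHom (algebraMap O (homogeneousSubmodule (Fin (3 + 1)) O 0))))) := inferInstance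
  haveI : IsClosedImmersion (Spec.map (CommRingCat.ofHom θ)) := IsClosedImmersion.spec_of_surjective _ hθ
  haveI hj₂ci : IsClosedImmersion j₂ := MorphismProperty.IsStableUnderBaseChange.of_isPullback hsq₂.flip inferInstance; haveI : IsLocallyNoetherian F₂ := LocallyOfFiniteType.isLocallyNoetherian j₂
  obtain ⟨ξ, hξ⟩ : ∃ ξ : ↥(Proj (homogeneousSubmodule (Fin (3 + 1)) O)), IsGenericPoint ξ (Set.range (ι ≫ Proj.map φ hφ' : H ⟶ Proj (homogeneousSubmodule (Fin (3 + 1)) O))) := QuasiSober.sober hYirr hYcl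
  have hne0 : ∀ II : X₁.IdealSheafData, (τ ≫ 𝟙 (Proj (homogeneousSubmodule (Fin (3 + 1)) O))) '' (II.support : Set X₁) ⊆ {p | ¬ IsGenericPoint p (Set.range (ι ≫ Proj.map φ hφ' : H ⟶ Proj (homogeneousSubmodule (Fin (3 + 1)) O)))} → II ≠ ⊥ := by
    intro II hoff h0; obtain ⟨ξ', hfib', -⟩ := Chain.fibre hch₁ hξ
    have hmem : ξ' ∈ (II.support : Set X₁) := by rw [h0, Scheme.IdealSheafData.support_bot]; trivial
    have hgen : (τ ≫ 𝟙 (Proj (homogeneousSubmodule (Fin (3 + 1)) O))) ξ' = ξ := by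
      have : ξ' ∈ (τ ≫ 𝟙 (Proj (homogeneousSubmodule (Fin (3 + 1)) O))) ⁻¹' {ξ} := by rw [hfib']; exact Set.mem_singleton ξ'
      exact this
    exact hoff ⟨ξ', hmem, rfl⟩ (hgen ▸ hξ)
  -- the pair's models: `𝓢 = (ker s)·𝒪_{X₁}` (exceptional) and `𝓟 = St (𝓛 ℓh)` (host plane), the face `𝓠 = St (𝓛 ℓj)`
  obtain ⟨⟨hP1, hP2, hP3, hP4, hP5⟩, -⟩ := hLt ℓh (by simp)
  have hEc : IsClosed (υ ⁻¹' {((vanishingIdeal (⟨closure (Set.range ι), isClosed_closure⟩ : Closeds (projectiveSpace 3 k).left)).subschemeι x₀ : (projectiveSpace 3 k).left)}) := hx₀.preimage υ.continuous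
  have hPc : IsClosed (closure (υ ⁻¹' ({y : (projectiveSpace 3 k).left | ℓh ∈ (y : ProjectiveSpectrum (homogeneousSubmodule (Fin (3 + 1)) k)).asHomogeneousIdeal} \ {((vanishingIdeal (⟨closure (Set.range ι), isClosed_closure⟩ : Closeds (projectiveSpace 3 k).left)).subschemeι x₀ : (projectiveSpace 3 k).left)}))) := isClosed_closure
  have hE1' : (s.ker.comap τ).comap j₂ = vanishingIdeal ⟨(υ ⁻¹' {((vanishingIdeal (⟨closure (Set.range ι), isClosed_closure⟩ : Closeds (projectiveSpace 3 k).left)).subschemeι x₀ : (projectiveSpace 3 k).left)}), hEc⟩ := by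
    rw [he1]; congr 1; exact Closeds.ext hEc.closure_eq
  have hP1' : (strictTransformIdeal τ s.ker (𝓛 ℓh)).comap j₂ = vanishingIdeal ⟨closure (υ ⁻¹' ({y : (projectiveSpace 3 k).left | ℓh ∈ (y : ProjectiveSpectrum (homogeneousSubmodule (Fin (3 + 1)) k)).asHomogeneousIdeal} \ {((vanishingIdeal (⟨closure (Set.range ι), isClosed_closure⟩ : Closeds (projectiveSpace 3 k).left)).subschemeι x₀ : (projectiveSpace 3 k).left)})), hPc⟩ := by
    rw [hP1]; congr 1; exact Closeds.ext closure_closure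
  have hW1' : vanishingIdeal ⟨(υ ⁻¹' {((vanishingIdeal (⟨closure (Set.range ι), isClosed_closure⟩ : Closeds (projectiveSpace 3 k).left)).subschemeι x₀ : (projectiveSpace 3 k).left)}), hEc⟩ ⊔ vanishingIdeal ⟨closure (υ ⁻¹' ({y : (projectiveSpace 3 k).left | ℓh ∈ (y : ProjectiveSpectrum (homogeneousSubmodule (Fin (3 + 1)) k)).asHomogeneousIdeal} \ {((vanishingIdeal (⟨closure (Set.range ι), isClosed_closure⟩ : Closeds (projectiveSpace 3 k).left)).subschemeι x₀ : (projectiveSpace 3 k).left)})), hPc⟩ = vanishingIdeal (⟨(υ ⁻¹' {((vanishingIdeal (⟨closure (Set.range ι), isClosed_closure⟩ : Closeds (projectiveSpace 3 k).left)).subschemeι x₀ : (projectiveSpace 3 k).left)}) ∩ closure (υ ⁻¹' ({y : (projectiveSpace 3 k).left | ℓh ∈ (y : ProjectiveSpectrum (homogeneousSubmodule (Fin (3 + 1)) k)).asHomogeneousIdeal} \ {((vanishingIdeal (⟨closure (Set.range ι), isClosed_closure⟩ : Closeds (projectiveSpace 3 k).left)).subschemeι x₀ : (projectiveSpace 3 k).left)})),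 hEc.inter hPc⟩ : Closeds F₂) := hW1
  have hCj : (s.ker.comap τ ⊔ strictTransformIdeal τ s.ker (𝓛 ℓh)).comap j₂ = vanishingIdeal ⟨((υ ⁻¹' {((vanishingIdeal (⟨closure (Set.range ι), isClosed_closure⟩ : Closeds (projectiveSpace 3 k).left)).subschemeι x₀ : (projectiveSpace 3 k).left)}) ∩ closure (υ ⁻¹' ({y : (projectiveSpace 3 k).left | ℓh ∈ (y : ProjectiveSpectrum (homogeneousSubmodule (Fin (3 + 1)) k)).asHomogeneousIdeal} \ {((vanishingIdeal (⟨closure (Set.range ι), isClosed_closure⟩ : Closeds (projectiveSpace 3 k).left)).subschemeι x₀ : (projectiveSpace 3 k).left)}))), hZ⟩ := by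
    rw [Scheme.IdealSheafData.comap_sup, hE1', hP1', hW1']
  -- the codimension binder at the closed crossing points (curve clause + T-DIM)
  have hWdim : ∀ g ∈ (υ ⁻¹' {((vanishingIdeal (⟨closure (Set.range ι), isClosed_closure⟩ : Closeds (projectiveSpace 3 k).left)).subschemeι x₀ : (projectiveSpace 3 k).left)}) ∩ closure (υ ⁻¹' ({y : (projectiveSpace 3 k).left | ℓh ∈ (y : ProjectiveSpectrum (homogeneousSubmodule (Fin (3 + 1)) k)).asHomogeneousIdeal} \ {((vanishingIdeal (⟨closure (Set.range ι), isClosed_closure⟩ : Closeds (projectiveSpace 3 k).left)).subschemeι x₀ : (projectiveSpace 3 k).left)})), IsClosed ({g} : Set F₂) →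
      ringKrullDim (F₂.presheaf.stalk g ⧸ stalkIdeal (vanishingIdeal (⟨(υ ⁻¹' {((vanishingIdeal (⟨closure (Set.range ι), isClosed_closure⟩ : Closeds (projectiveSpace 3 k).left)).subschemeι x₀ : (projectiveSpace 3 k).left)}) ∩ closure (υ ⁻¹' ({y : (projectiveSpace 3 k).left | ℓh ∈ (y : ProjectiveSpectrum (homogeneousSubmodule (Fin (3 + 1)) k)).asHomogeneousIdeal} \ {((vanishingIdeal (⟨closure (Set.range ι), isClosed_closure⟩ : Closeds (projectiveSpace 3 k).left)).subschemeι x₀ : (projectiveSpace 3 k).left)})), hEc.inter hPc⟩ : Closeds F₂)) g) + 3 = ringKrullDim (X₁.presheaf.stalk (j₂ g)) := by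
    intro g hg hgc
    have hgr : g ∈ Set.range (redSubι F₂ ((υ ⁻¹' {((vanishingIdeal (⟨closure (Set.range ι), isClosed_closure⟩ : Closeds (projectiveSpace 3 k).left)).subschemeι x₀ : (projectiveSpace 3 k).left)}) ∩ closure (υ ⁻¹' ({y : (projectiveSpace 3 k).left | ℓh ∈ (y : ProjectiveSpectrum (homogeneousSubmodule (Fin (3 + 1)) k)).asHomogeneousIdeal} \ {((vanishingIdeal (⟨closure (Set.range ι), isClosed_closure⟩ : Closeds (projectiveSpace 3 k).left)).subschemeι x₀ : (projectiveSpace 3 k).left)}))) hZ) := by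
      change g ∈ Set.range (vanishingIdeal (⟨((υ ⁻¹' {((vanishingIdeal (⟨closure (Set.range ι), isClosed_closure⟩ : Closeds (projectiveSpace 3 k).left)).subschemeι x₀ : (projectiveSpace 3 k).left)}) ∩ closure (υ ⁻¹' ({y : (projectiveSpace 3 k).left | ℓh ∈ (y : ProjectiveSpectrum (homogeneousSubmodule (Fin (3 + 1)) k)).asHomogeneousIdeal} \ {((vanishingIdeal (⟨closure (Set.range ι), isClosed_closure⟩ : Closeds (projectiveSpace 3 k).left)).subschemeι x₀ : (projectiveSpace 3 k).left)}))), hZ⟩ : Closeds F₂)).subschemeι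
      rw [Scheme.IdealSheafData.range_subschemeι, Scheme.IdealSheafData.coe_support_vanishingIdeal]; exact hg
    obtain ⟨z, hz⟩ := hgr
    have hzc : IsClosed ({z} : Set ↥(redSub F₂ ((υ ⁻¹' {((vanishingIdeal (⟨closure (Set.range ι), isClosed_closure⟩ : Closeds (projectiveSpace 3 k).left)).subschemeι x₀ : (projectiveSpace 3 k).left)}) ∩ closure (υ ⁻¹' ({y : (projectiveSpace 3 k).left | ℓh ∈ (y : ProjectiveSpectrum (homogeneousSubmodule (Fin (3 + 1)) k)).asHomogeneousIdeal} \ {((vanishingIdeal (⟨closure (Set.range ι), isClosed_closure⟩ : Closeds (projectiveSpace 3 k).left)).subschemeι x₀ : (projectiveSpace 3 k).left)}))) hZ)) := by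
      have h1 : ({z} : Set ↥(redSub F₂ ((υ ⁻¹' {((vanishingIdeal (⟨closure (Set.range ι), isClosed_closure⟩ : Closeds (projectiveSpace 3 k).left)).subschemeι x₀ : (projectiveSpace 3 k).left)}) ∩ closure (υ ⁻¹' ({y : (projectiveSpace 3 k).left | ℓh ∈ (y : ProjectiveSpectrum (homogeneousSubmodule (Fin (3 + 1)) k)).asHomogeneousIdeal} \ {((vanishingIdeal (⟨closure (Set.range ι), isClosed_closure⟩ : Closeds (projectiveSpace 3 k).left)).subschemeι x₀ : (projectiveSpace 3 k).left)}))) hZ)) = (redSubι F₂ ((υ ⁻¹' {((vanishingIdeal (⟨closure (Set.range ι), isClosed_closure⟩ : Closeds (projectiveSpace 3 k).left)).subschemeι x₀ : (projectiveSpace 3 k).left)}) ∩ closure (υ ⁻¹' ({y : (projectiveSpace 3 k).left | ℓh ∈ (y : ProjectiveSpectrum (homogeneousSubmodule (Fin (3 + 1)) k)).asHomogeneousIdeal} \ {((vanishingIdeal (⟨closure (Set.range ι), isClosed_closure⟩ : Closeds (projectiveSpace 3 k).left)).subschemeι x₀ : (projectiveSpace 3 k).left)}))) hZ) ⁻¹'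 {g} := by
        ext z'; simp only [Set.mem_singleton_iff, Set.mem_preimage]; constructor
        · rintro rfl; exact hz
        · intro h; exact (redSubι F₂ ((υ ⁻¹' {((vanishingIdeal (⟨closure (Set.range ι), isClosed_closure⟩ : Closeds (projectiveSpace 3 k).left)).subschemeι x₀ : (projectiveSpace 3 k).left)}) ∩ closure (υ ⁻¹' ({y : (projectiveSpace 3 k).left | ℓh ∈ (y : ProjectiveSpectrum (homogeneousSubmodule (Fin (3 + 1)) k)).asHomogeneousIdeal} \ {((vanishingIdeal (⟨closure (Set.range ι), isClosed_closure⟩ : Closeds (projectiveSpace 3 k).left)).subschemeι x₀ : (projectiveSpace 3 k).left)}))) hZ).isClosedEmbedding.injective (h.trans hz.symm)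
      rw [h1]; exact hgc.preimage (redSubι F₂ ((υ ⁻¹' {((vanishingIdeal (⟨closure (Set.range ι), isClosed_closure⟩ : Closeds (projectiveSpace 3 k).left)).subschemeι x₀ : (projectiveSpace 3 k).left)}) ∩ closure (υ ⁻¹' ({y : (projectiveSpace 3 k).left | ℓh ∈ (y : ProjectiveSpectrum (homogeneousSubmodule (Fin (3 + 1)) k)).asHomogeneousIdeal} \ {((vanishingIdeal (⟨closure (Set.range ι), isClosed_closure⟩ : Closeds (projectiveSpace 3 k).left)).subschemeι x₀ : (projectiveSpace 3 k).left)}))) hZ).continuous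
    have h1 : ringKrullDim (F₂.presheaf.stalk g ⧸ stalkIdeal (vanishingIdeal (⟨((υ ⁻¹' {((vanishingIdeal (⟨closure (Set.range ι), isClosed_closure⟩ : Closeds (projectiveSpace 3 k).left)).subschemeι x₀ : (projectiveSpace 3 k).left)}) ∩ closure (υ ⁻¹' ({y : (projectiveSpace 3 k).left | ℓh ∈ (y : ProjectiveSpectrum (homogeneousSubmodule (Fin (3 + 1)) k)).asHomogeneousIdeal} \ {((vanishingIdeal (⟨closure (Set.range ι), isClosed_closure⟩ : Closeds (projectiveSpace 3 k).left)).subschemeι x₀ : (projectiveSpace 3 k).left)}))), hZ⟩ : Closeds F₂)) g) = ((1 : ℕ) : WithBot ℕ∞) := by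
      rw [← hz, ← Literature.AlgebraicGeometry.Resolution.ringKrullDim_stalk_subscheme]; exact hZdim z hzc
    have hjc : IsClosed ({j₂ g} : Set X₁) := by
      have := j₂.isClosedMap _ hgc; rwa [Set.image_singleton] at this
    have hjs : ((τ ≫ 𝟙 (Proj (homogeneousSubmodule (Fin (3 + 1)) O))) ≫ (Proj.toSpecZero (homogeneousSubmodule (Fin (3 + 1)) O) ≫ Spec.map (CommRingCat.ofHom (algebraMap O (homogeneousSubmodule (Fin (3 + 1)) O 0))))).base (j₂ g) = closedPoint O := by
      have h2 : j₂ g ∈ Set.range j₂ := ⟨g, rfl⟩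
      rw [range_eq_preimage_of_isPullback hsq₂, range_specMap_of_surjective_of_field θ hθ] at h2
      exact h2
    have h4 : ringKrullDim (X₁.presheaf.stalk (j₂ g)) = ((3 + 1 : ℕ) : WithBot ℕ∞) :=
      ringKrullDim_stalk_eq_succ_of_chain (Proj.toSpecZero (homogeneousSubmodule (Fin (3 + 1)) O) ≫ Spec.map (CommRingCat.ofHom (algebraMap O (homogeneousSubmodule (Fin (3 + 1)) O 0)))) 3 hξ hch₁ hjc hjs
    rw [h1, h4]; rfl
  -- the CAR centre `𝒞 = 𝓢 ⊔ 𝓟` is regular and `O`-flat (res-L1-w45b-lead-1's pair lemmas)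
  have hCreg : Scheme.IsRegular (s.ker.comap τ ⊔ strictTransformIdeal τ s.ker (𝓛 ℓh)).subscheme := isRegular_subscheme_sup_of_trace_crossing hreg₁ hsq₂ hθ hE1' he2 hP1' hP2 hW1' hZreg hWdim
  have hCfl : Flat ((s.ker.comap τ ⊔ strictTransformIdeal τ s.ker (𝓛 ℓh)).subschemeι ≫ (τ ≫ 𝟙 (Proj (homogeneousSubmodule (Fin (3 + 1)) O))) ≫ (Proj.toSpecZero (homogeneousSubmodule (Fin (3 + 1)) O) ≫ Spec.map (CommRingCat.ofHom (algebraMap O (homogeneousSubmodule (Fin (3 + 1)) O 0))))) :=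
    flat_subschemeι_sup_of_trace_crossing hreg₁ hsq₂ hθ hE1' he2 hP1' hP2 hW1' hZreg hWdim
  have hoff : (τ ≫ 𝟙 (Proj (homogeneousSubmodule (Fin (3 + 1)) O))) '' ((s.ker.comap τ ⊔ strictTransformIdeal τ s.ker (𝓛 ℓh)).support : Set X₁) ⊆ {y | ¬ IsGenericPoint y (Set.range (ι ≫ Proj.map φ hφ' : H ⟶ Proj (homogeneousSubmodule (Fin (3 + 1)) O)))} :=
    image_support_subset_not_isGenericPoint_of_chain θ hθ (Proj.toSpecZero (homogeneousSubmodule (Fin (3 + 1)) O) ≫ Spec.map (CommRingCat.ofHom (algebraMap O (homogeneousSubmodule (Fin (3 + 1)) O 0)))) (Set.range (ι ≫ Proj.map φ hφ' : H ⟶ Proj (homogeneousSubmodule (Fin (3 + 1)) O))) hYsp (τ ≫ 𝟙 (Proj (homogeneousSubmodule (Fin (3 + 1)) O))) (j₂ '' closure (υ ⁻¹' (Set.range ι \ {((vanishingIdeal (⟨closure (Set.range ι), isClosed_closure⟩ : Closeds (projectiveSpace 3 k).left)).subschemeι x₀ : (projectiveSpace 3 k).left)}))) hch₁ j₂ t₂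 hsq₂ (closure (υ ⁻¹' (Set.range ι \ {((vanishingIdeal (⟨closure (Set.range ι), isClosed_closure⟩ : Closeds (projectiveSpace 3 k).left)).subschemeι x₀ : (projectiveSpace 3 k).left)}))) rfl _ ((υ ⁻¹' {((vanishingIdeal (⟨closure (Set.range ι), isClosed_closure⟩ : Closeds (projectiveSpace 3 k).left)).subschemeι x₀ : (projectiveSpace 3 k).left)}) ∩ closure (υ ⁻¹' ({y : (projectiveSpace 3 k).left | ℓh ∈ (y : ProjectiveSpectrum (homogeneousSubmodule (Fin (3 + 1)) k)).asHomogeneousIdeal} \ {((vanishingIdeal (⟨closure (Set.range ι), isClosed_closure⟩ : Closeds (projectiveSpace 3 k).left)).subschemeι x₀ : (projectiveSpace 3 k).left)}))) hZ hCj hTZ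
  -- the CAR round: blow-up of `𝒞`, its `Ch`-stage and the model square for `υ'`
  have hDT : (((vanishingIdeal (⟨((υ ⁻¹' {((vanishingIdeal (⟨closure (Set.range ι), isClosed_closure⟩ : Closeds (projectiveSpace 3 k).left)).subschemeι x₀ : (projectiveSpace 3 k).left)}) ∩ closure (υ ⁻¹' ({y : (projectiveSpace 3 k).left | ℓh ∈ (y : ProjectiveSpectrum (homogeneousSubmodule (Fin (3 + 1)) k)).asHomogeneousIdeal} \ {((vanishingIdeal (⟨closure (Set.range ι), isClosed_closure⟩ : Closeds (projectiveSpace 3 k).left)).subschemeι x₀ : (projectiveSpace 3 k).left)}))), hZ⟩ : Closeds F₂)) : F₂.IdealSheafData).support : Set F₂) ⊆ closure (υ ⁻¹' (Set.range ι \ {((vanishingIdeal (⟨closure (Set.range ι), isClosed_closure⟩ : Closeds (projectiveSpace 3 k).left)).subschemeι x₀ : (projectiveSpace 3 k).left)})) := by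
    rw [Scheme.IdealSheafData.coe_support_vanishingIdeal]; exact hZT
  have hTD : ¬ closure (υ ⁻¹' (Set.range ι \ {((vanishingIdeal (⟨closure (Set.range ι), isClosed_closure⟩ : Closeds (projectiveSpace 3 k).left)).subschemeι x₀ : (projectiveSpace 3 k).left)})) ⊆ (((vanishingIdeal (⟨((υ ⁻¹' {((vanishingIdeal (⟨closure (Set.range ι), isClosed_closure⟩ : Closeds (projectiveSpace 3 k).left)).subschemeι x₀ : (projectiveSpace 3 k).left)}) ∩ closure (υ ⁻¹' ({y : (projectiveSpace 3 k).left | ℓh ∈ (y : ProjectiveSpectrum (homogeneousSubmodule (Fin (3 + 1)) k)).asHomogeneousIdeal} \ {((vanishingIdeal (⟨closure (Set.range ι), isClosed_closure⟩ : Closeds (projectiveSpace 3 k).left)).subschemeι x₀ : (projectiveSpace 3 k).left)}))), hZ⟩ : Closeds F₂)) : F₂.IdealSheafData).support : Set F₂) := by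
    rw [Scheme.IdealSheafData.coe_support_vanishingIdeal]; exact hTZ
  obtain ⟨X₃, τ₃, hτ₃⟩ := exists_isBlowup X₁ (s.ker.comap τ ⊔ strictTransformIdeal τ s.ker (𝓛 ℓh))
  obtain ⟨hX₃i, hX₃n, hX₃r, hX₃dom, hF₃i, hirr₃, j₃, t₃, hsq₃, hcomm₃, hCh₃⟩ :=
    modelStep_chain O k θ hθ _ (Proj.toSpecZero (homogeneousSubmodule (Fin (3 + 1)) O) ≫ Spec.map (CommRingCat.ofHom (algebraMap O (homogeneousSubmodule (Fin (3 + 1)) O 0)))) (Set.range (ι ≫ Proj.map φ hφ' : H ⟶ Proj (homogeneousSubmodule (Fin (3 + 1)) O))) hYirr hYcl Ch hChSplit hChStep X₁ (τ ≫ 𝟙 (Proj (homogeneousSubmodule (Fin (3 + 1)) O))) (j₂ '' closure (υ ⁻¹' (Set.range ι \ {((vanishingIdeal (⟨closure (Set.range ι), isClosed_closure⟩ : Closeds (projectiveSpace 3 k).left)).subschemeι x₀ : (projectiveSpace 3 k).left)}))) hCh₁ hreg₁ hdom₁ F₂ j₂ t₂ hsq₂ (closure (υ ⁻¹' (Set.range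 ι \ {((vanishingIdeal (⟨closure (Set.range ι), isClosed_closure⟩ : Closeds (projectiveSpace 3 k).left)).subschemeι x₀ : (projectiveSpace 3 k).left)}))) rfl
      _ (vanishingIdeal (⟨((υ ⁻¹' {((vanishingIdeal (⟨closure (Set.range ι), isClosed_closure⟩ : Closeds (projectiveSpace 3 k).left)).subschemeι x₀ : (projectiveSpace 3 k).left)}) ∩ closure (υ ⁻¹' ({y : (projectiveSpace 3 k).left | ℓh ∈ (y : ProjectiveSpectrum (homogeneousSubmodule (Fin (3 + 1)) k)).asHomogeneousIdeal} \ {((vanishingIdeal (⟨closure (Set.range ι), isClosed_closure⟩ : Closeds (projectiveSpace 3 k).left)).subschemeι x₀ : (projectiveSpace 3 k).left)}))), hZ⟩ : Closeds F₂)) hCj hCreg hCfl hoff hDT hTD X₃ τ₃ hτ₃ F₃ υ' hυ'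
  rw [Scheme.IdealSheafData.coe_support_vanishingIdeal] at hirr₃ hCh₃
  haveI := hX₃n; haveI := hX₃i; haveI := hF₃i; haveI := hX₃dom; haveI hj₃ci : IsClosedImmersion j₃ := MorphismProperty.IsStableUnderBaseChange.of_isPullback hsq₃.flip inferInstance
  haveI : IsLocallyNoetherian F₃ := LocallyOfFiniteType.isLocallyNoetherian j₃
  have hch₃ : Chain _ (Set.range (ι ≫ Proj.map φ hφ' : H ⟶ Proj (homogeneousSubmodule (Fin (3 + 1)) O))) X₃ (τ₃ ≫ τ ≫ 𝟙 (Proj (homogeneousSubmodule (Fin (3 + 1)) O))) _ := hChSplit _ _ _ hCh₃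
  obtain ⟨-, -, hσ₃prop⟩ := chain_isRegular _ (Set.range (ι ≫ Proj.map φ hφ' : H ⟶ Proj (homogeneousSubmodule (Fin (3 + 1)) O))) X₃ _ _ hch₃ hPnoeth hPreg
  haveI := hσ₃prop
  haveI : IsProper ((τ₃ ≫ τ ≫ 𝟙 (Proj (homogeneousSubmodule (Fin (3 + 1)) O))) ≫ (Proj.toSpecZero (homogeneousSubmodule (Fin (3 + 1)) O) ≫ Spec.map (CommRingCat.ofHom (algebraMap O (homogeneousSubmodule (Fin (3 + 1)) O 0))))) := inferInstance
  haveI : LocallyOfFiniteType t₃ := MorphismProperty.IsStableUnderBaseChange.of_isPullback hsq₃ inferInstance; haveI : JacobsonSpace F₃ := LocallyOfFiniteType.jacobsonSpace t₃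
  haveI : CompactSpace X₃ := QuasiCompact.compactSpace_of_compactSpace ((τ₃ ≫ τ ≫ 𝟙 (Proj (homogeneousSubmodule (Fin (3 + 1)) O))) ≫ (Proj.toSpecZero (homogeneousSubmodule (Fin (3 + 1)) O) ≫ Spec.map (CommRingCat.ofHom (algebraMap O (homogeneousSubmodule (Fin (3 + 1)) O 0)))))
  have hfr : ∀ x ∈ (s.ker.comap τ ⊔ strictTransformIdeal τ s.ker (𝓛 ℓh)).support, ∃ c : Fin 2 → X₁.presheaf.stalk x, Ideal.span (Set.range c) = stalkIdeal (s.ker.comap τ ⊔ strictTransformIdeal τ s.ker (𝓛 ℓh)) x ∧ IsQuasiRegular c :=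
    hFrame_of_ringKrullDim_redSub O k θ hθ _ (Proj.toSpecZero (homogeneousSubmodule (Fin (3 + 1)) O) ≫ Spec.map (CommRingCat.ofHom (algebraMap O (homogeneousSubmodule (Fin (3 + 1)) O 0)))) (Set.range (ι ≫ Proj.map φ hφ' : H ⟶ Proj (homogeneousSubmodule (Fin (3 + 1)) O))) hYirr hYcl hPnoeth hPreg Ch hChSplit (closure (υ ⁻¹' (Set.range ι \ {((vanishingIdeal (⟨closure (Set.range ι), isClosed_closure⟩ : Closeds (projectiveSpace 3 k).left)).subschemeι x₀ : (projectiveSpace 3 k).left)}))) ((υ ⁻¹' {((vanishingIdeal (⟨closure (Set.range ι), isClosed_closure⟩ : Closeds (projectiveSpace 3 k).left)).subschemeι x₀ : (projectiveSpace 3 k).left)}) ∩ closure (υ ⁻¹' ({y : (projectiveSpace 3 k).left | ℓh ∈ (y : ProjectiveSpectrum (homogeneousSubmodule (Fin (3 + 1)) k)).asHomogeneousIdeal} \ {((vanishingIdeal (⟨closure (Set.range ι), isClosed_closure⟩ : Closeds (projectiveSpace 3 k).left)).subschemeι x₀ : (projectiveSpace 3 k).left)}))) hZ hZdim X₁ (τ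 ≫ 𝟙 (Proj (homogeneousSubmodule (Fin (3 + 1)) O))) (j₂ '' closure (υ ⁻¹' (Set.range ι \ {((vanishingIdeal (⟨closure (Set.range ι), isClosed_closure⟩ : Closeds (projectiveSpace 3 k).left)).subschemeι x₀ : (projectiveSpace 3 k).left)}))) j₂ t₂ _ hCh₁ hint₁
      hnoeth₁ hreg₁ hdom₁ hsq₂ rfl hCj hCfl hCreg
  have hC0 : s.ker.comap τ ⊔ strictTransformIdeal τ s.ker (𝓛 ℓh) ≠ ⊥ := fun h => hne0 _ he4 (le_bot_iff.mp (h ▸ le_sup_left))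
  -- THE PAIR MEMBERS `St E`, `St² Π` (HT2′)
  have hLE : TCPlus.LetterDatum O _ (Proj.toSpecZero (homogeneousSubmodule (Fin (3 + 1)) O) ≫ Spec.map (CommRingCat.ofHom (algebraMap O (homogeneousSubmodule (Fin (3 + 1)) O 0)))) (Set.range (ι ≫ Proj.map φ hφ' : H ⟶ Proj (homogeneousSubmodule (Fin (3 + 1)) O))) F₃ X₃ (τ₃ ≫ τ ≫ 𝟙 (Proj (homogeneousSubmodule (Fin (3 + 1)) O))) j₃ (closure (υ' ⁻¹' ((υ ⁻¹' {((vanishingIdeal (⟨closure (Set.range ι), isClosed_closure⟩ : Closeds (projectiveSpace 3 k).left)).subschemeι x₀ : (projectiveSpace 3 k).left)}) \ ((υ ⁻¹' {((vanishingIdeal (⟨closure (Set.range ι), isClosed_closure⟩ : Closeds (projectiveSpace 3 k).left)).subschemeι x₀ : (projectiveSpace 3 k).left)}) ∩ closure (υ ⁻¹' ({y : (projectiveSpace 3 k).left | ℓh ∈ (y : ProjectiveSpectrum (homogeneousSubmodule (Fin (3 + 1)) k)).asHomogeneousIdeal} \ {((vanishingIdeal (⟨closure (Set.range ι), isClosed_closure⟩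 : Closeds (projectiveSpace 3 k).left)).subschemeι x₀ : (projectiveSpace 3 k).left)})))))) :=
    TCPlus.letterDatum_transport_hostedRound' O k θ hθ (Proj.toSpecZero (homogeneousSubmodule (Fin (3 + 1)) O) ≫ Spec.map (CommRingCat.ofHom (algebraMap O (homogeneousSubmodule (Fin (3 + 1)) O 0)))) (Set.range (ι ≫ Proj.map φ hφ' : H ⟶ Proj (homogeneousSubmodule (Fin (3 + 1)) O))) (τ ≫ 𝟙 (Proj (homogeneousSubmodule (Fin (3 + 1)) O))) hreg₁ j₂ t₂ hsq₂ hEc _ hE1' he2 he3 he4 he5 (hne0 _ he4) _ le_sup_left hZ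
      hCj hCfl hCreg hfr hτ₃ hυ' j₃ t₃ hsq₃ hcomm₃
  have hLP : TCPlus.LetterDatum O _ (Proj.toSpecZero (homogeneousSubmodule (Fin (3 + 1)) O) ≫ Spec.map (CommRingCat.ofHom (algebraMap O (homogeneousSubmodule (Fin (3 + 1)) O 0)))) (Set.range (ι ≫ Proj.map φ hφ' : H ⟶ Proj (homogeneousSubmodule (Fin (3 + 1)) O))) F₃ X₃ (τ₃ ≫ τ ≫ 𝟙 (Proj (homogeneousSubmodule (Fin (3 + 1)) O))) j₃ (closure (υ' ⁻¹' (closure (υ ⁻¹' ({y : (projectiveSpace 3 k).left | ℓh ∈ (y : ProjectiveSpectrum (homogeneousSubmodule (Fin (3 + 1)) k)).asHomogeneousIdeal} \ {((vanishingIdeal (⟨closure (Set.range ι), isClosed_closure⟩ : Closeds (projectiveSpace 3 k).left)).subschemeι x₀ : (projectiveSpace 3 k).left)})) \ ((υ ⁻¹' {((vanishingIdeal (⟨closure (Set.range ι), isClosed_closure⟩ : Closeds (projectiveSpace 3 k).left)).subschemeι x₀ : (projectiveSpace 3 k).left)}) ∩ closure (υ ⁻¹' ({y : (projectiveSpace 3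 k).left | ℓh ∈ (y : ProjectiveSpectrum (homogeneousSubmodule (Fin (3 + 1)) k)).asHomogeneousIdeal} \ {((vanishingIdeal (⟨closure (Set.range ι), isClosed_closure⟩ : Closeds (projectiveSpace 3 k).left)).subschemeι x₀ : (projectiveSpace 3 k).left)})))))) :=
    TCPlus.letterDatum_transport_hostedRound' O k θ hθ (Proj.toSpecZero (homogeneousSubmodule (Fin (3 + 1)) O) ≫ Spec.map (CommRingCat.ofHom (algebraMap O (homogeneousSubmodule (Fin (3 + 1)) O 0)))) (Set.range (ι ≫ Proj.map φ hφ' : H ⟶ Proj (homogeneousSubmodule (Fin (3 + 1)) O))) (τ ≫ 𝟙 (Proj (homogeneousSubmodule (Fin (3 + 1)) O))) hreg₁ j₂ t₂ hsq₂ hPc _ hP1' hP2 hP3 hP4 hP5 (hne0 _ hP4) _ le_sup_right hZ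
      hCj hCfl hCreg hfr hτ₃ hυ' j₃ t₃ hsq₃ hcomm₃
  -- THE IMMATURE KEY LETTER THROUGH THE CAR ROUND (Δ2b at `a' = 1`)
  have hordC : strictTransformIdeal τ s.ker 𝓜 ≤ s.ker.comap τ ⊔ strictTransformIdeal τ s.ker (𝓛 ℓh) := by
    refine hincS.trans (sup_le (sup_le ?_ ?_) ?_)
    · obtain ⟨a', rfl⟩ : ∃ a', a = a' + 1 := ⟨a - 1, by omega⟩
      rw [pow_succ]
      exact (pow_mul_le _ _ _).trans le_sup_right
    · calc strictTransformIdeal τ s.ker (𝓛 ℓh) * s.ker.comap τ = strictTransformIdeal τ s.ker (𝓛 ℓh) ^ 1 * s.ker.comap τ := by rw [pow_one]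
        _ ≤ s.ker.comap τ := pow_mul_le _ _ _
        _ ≤ _ := le_sup_left
    · calc s.ker.comap τ * strictTransformIdeal τ s.ker (𝓛 ℓj) = strictTransformIdeal τ s.ker (𝓛 ℓj) ^ 1 * s.ker.comap τ := by rw [pow_one, mul_comm]
        _ ≤ s.ker.comap τ := pow_mul_le _ _ _
        _ ≤ _ := le_sup_left
  have hord : ∀ z ∈ ((υ ⁻¹' {((vanishingIdeal (⟨closure (Set.range ι), isClosed_closure⟩ : Closeds (projectiveSpace 3 k).left)).subschemeι x₀ : (projectiveSpace 3 k).left)}) ∩ closure (υ ⁻¹' ({y : (projectiveSpace 3 k).left | ℓh ∈ (y : ProjectiveSpectrum (homogeneousSubmodule (Fin (3 + 1)) k)).asHomogeneousIdeal} \ {((vanishingIdeal (⟨closure (Set.range ι), isClosed_closure⟩ : Closeds (projectiveSpace 3 k).left)).subschemeι x₀ : (projectiveSpace 3 k).left)}))), IsClosed ({z} : Set F₂) →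
      stalkIdeal (strictTransformIdeal τ s.ker 𝓜) (j₂ z) ≤ stalkIdeal (s.ker.comap τ ⊔ strictTransformIdeal τ s.ker (𝓛 ℓh)) (j₂ z) ^ 1 :=
    fun z _ _ => by rw [pow_one]; exact stalkIdeal_mono hordC _
  have hS1c : (strictTransformIdeal τ s.ker 𝓜).comap j₂ = vanishingIdeal ⟨closure (υ ⁻¹' ({y : (projectiveSpace 3 k).left | G ∈ (y : ProjectiveSpectrum (homogeneousSubmodule (Fin (3 + 1)) k)).asHomogeneousIdeal} \ {((vanishingIdeal (⟨closure (Set.range ι), isClosed_closure⟩ : Closeds (projectiveSpace 3 k).left)).subschemeι x₀ : (projectiveSpace 3 k).left)})), isClosed_closure⟩ := by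
    rw [hS1]; congr 1; exact Closeds.ext closure_closure
  have hgen' : ∀ z ∈ ((υ ⁻¹' {((vanishingIdeal (⟨closure (Set.range ι), isClosed_closure⟩ : Closeds (projectiveSpace 3 k).left)).subschemeι x₀ : (projectiveSpace 3 k).left)}) ∩ closure (υ ⁻¹' ({y : (projectiveSpace 3 k).left | ℓh ∈ (y : ProjectiveSpectrum (homogeneousSubmodule (Fin (3 + 1)) k)).asHomogeneousIdeal} \ {((vanishingIdeal (⟨closure (Set.range ι), isClosed_closure⟩ : Closeds (projectiveSpace 3 k).left)).subschemeι x₀ : (projectiveSpace 3 k).left)}))), IsClosed ({z} : Set F₂) →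
      ¬ stalkIdeal ((strictTransformIdeal τ s.ker 𝓜).comap j₂) z ≤ stalkIdeal (vanishingIdeal (⟨((υ ⁻¹' {((vanishingIdeal (⟨closure (Set.range ι), isClosed_closure⟩ : Closeds (projectiveSpace 3 k).left)).subschemeι x₀ : (projectiveSpace 3 k).left)}) ∩ closure (υ ⁻¹' ({y : (projectiveSpace 3 k).left | ℓh ∈ (y : ProjectiveSpectrum (homogeneousSubmodule (Fin (3 + 1)) k)).asHomogeneousIdeal} \ {((vanishingIdeal (⟨closure (Set.range ι), isClosed_closure⟩ : Closeds (projectiveSpace 3 k).left)).subschemeι x₀ : (projectiveSpace 3 k).left)}))), hZ⟩ : Closeds F₂)) z ^ (1 + 1) := by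
    intro z hz hzc; rw [hS1c]; exact hgen z hz hzc
  have hcodim : ∀ z ∈ ((υ ⁻¹' {((vanishingIdeal (⟨closure (Set.range ι), isClosed_closure⟩ : Closeds (projectiveSpace 3 k).left)).subschemeι x₀ : (projectiveSpace 3 k).left)}) ∩ closure (υ ⁻¹' ({y : (projectiveSpace 3 k).left | ℓh ∈ (y : ProjectiveSpectrum (homogeneousSubmodule (Fin (3 + 1)) k)).asHomogeneousIdeal} \ {((vanishingIdeal (⟨closure (Set.range ι), isClosed_closure⟩ : Closeds (projectiveSpace 3 k).left)).subschemeι x₀ : (projectiveSpace 3 k).left)}))), IsClosed ({z} : Set F₂) →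
      ringKrullDim (F₂.presheaf.stalk z ⧸ stalkIdeal (vanishingIdeal (⟨((υ ⁻¹' {((vanishingIdeal (⟨closure (Set.range ι), isClosed_closure⟩ : Closeds (projectiveSpace 3 k).left)).subschemeι x₀ : (projectiveSpace 3 k).left)}) ∩ closure (υ ⁻¹' ({y : (projectiveSpace 3 k).left | ℓh ∈ (y : ProjectiveSpectrum (homogeneousSubmodule (Fin (3 + 1)) k)).asHomogeneousIdeal} \ {((vanishingIdeal (⟨closure (Set.range ι), isClosed_closure⟩ : Closeds (projectiveSpace 3 k).left)).subschemeι x₀ : (projectiveSpace 3 k).left)}))), hZ⟩ : Closeds F₂)) z) + 2 = ringKrullDim (F₂.presheaf.stalk z) := by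
    intro z hz hzc
    have hgr : z ∈ Set.range (redSubι F₂ ((υ ⁻¹' {((vanishingIdeal (⟨closure (Set.range ι), isClosed_closure⟩ : Closeds (projectiveSpace 3 k).left)).subschemeι x₀ : (projectiveSpace 3 k).left)}) ∩ closure (υ ⁻¹' ({y : (projectiveSpace 3 k).left | ℓh ∈ (y : ProjectiveSpectrum (homogeneousSubmodule (Fin (3 + 1)) k)).asHomogeneousIdeal} \ {((vanishingIdeal (⟨closure (Set.range ι), isClosed_closure⟩ : Closeds (projectiveSpace 3 k).left)).subschemeι x₀ : (projectiveSpace 3 k).left)}))) hZ) := by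
      change z ∈ Set.range (vanishingIdeal (⟨((υ ⁻¹' {((vanishingIdeal (⟨closure (Set.range ι), isClosed_closure⟩ : Closeds (projectiveSpace 3 k).left)).subschemeι x₀ : (projectiveSpace 3 k).left)}) ∩ closure (υ ⁻¹' ({y : (projectiveSpace 3 k).left | ℓh ∈ (y : ProjectiveSpectrum (homogeneousSubmodule (Fin (3 + 1)) k)).asHomogeneousIdeal} \ {((vanishingIdeal (⟨closure (Set.range ι), isClosed_closure⟩ : Closeds (projectiveSpace 3 k).left)).subschemeι x₀ : (projectiveSpace 3 k).left)}))), hZ⟩ : Closeds F₂)).subschemeι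
      rw [Scheme.IdealSheafData.range_subschemeι, Scheme.IdealSheafData.coe_support_vanishingIdeal]; exact hz
    obtain ⟨z', hz'⟩ := hgr
    have hzc' : IsClosed ({z'} : Set ↥(redSub F₂ ((υ ⁻¹' {((vanishingIdeal (⟨closure (Set.range ι), isClosed_closure⟩ : Closeds (projectiveSpace 3 k).left)).subschemeι x₀ : (projectiveSpace 3 k).left)}) ∩ closure (υ ⁻¹' ({y : (projectiveSpace 3 k).left | ℓh ∈ (y : ProjectiveSpectrum (homogeneousSubmodule (Fin (3 + 1)) k)).asHomogeneousIdeal} \ {((vanishingIdeal (⟨closure (Set.range ι), isClosed_closure⟩ : Closeds (projectiveSpace 3 k).left)).subschemeι x₀ : (projectiveSpace 3 k).left)}))) hZ)) := by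
      have h1 : ({z'} : Set ↥(redSub F₂ ((υ ⁻¹' {((vanishingIdeal (⟨closure (Set.range ι), isClosed_closure⟩ : Closeds (projectiveSpace 3 k).left)).subschemeι x₀ : (projectiveSpace 3 k).left)}) ∩ closure (υ ⁻¹' ({y : (projectiveSpace 3 k).left | ℓh ∈ (y : ProjectiveSpectrum (homogeneousSubmodule (Fin (3 + 1)) k)).asHomogeneousIdeal} \ {((vanishingIdeal (⟨closure (Set.range ι), isClosed_closure⟩ : Closeds (projectiveSpace 3 k).left)).subschemeι x₀ : (projectiveSpace 3 k).left)}))) hZ)) = (redSubι F₂ ((υ ⁻¹' {((vanishingIdeal (⟨closure (Set.range ι), isClosed_closure⟩ : Closeds (projectiveSpace 3 k).left)).subschemeι x₀ : (projectiveSpace 3 k).left)}) ∩ closure (υ ⁻¹' ({y : (projectiveSpace 3 k).left | ℓh ∈ (y : ProjectiveSpectrum (homogeneousSubmodule (Fin (3 + 1)) k)).asHomogeneousIdeal} \ {((vanishingIdeal (⟨closure (Set.range ι), isClosed_closure⟩ : Closeds (projectiveSpace 3 k).left)).subschemeι x₀ : (projectiveSpace 3 k).left)}))) hZ) ⁻¹'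 {z} := by
        ext z''; simp only [Set.mem_singleton_iff, Set.mem_preimage]; constructor
        · rintro rfl; exact hz'
        · intro h; exact (redSubι F₂ ((υ ⁻¹' {((vanishingIdeal (⟨closure (Set.range ι), isClosed_closure⟩ : Closeds (projectiveSpace 3 k).left)).subschemeι x₀ : (projectiveSpace 3 k).left)}) ∩ closure (υ ⁻¹' ({y : (projectiveSpace 3 k).left | ℓh ∈ (y : ProjectiveSpectrum (homogeneousSubmodule (Fin (3 + 1)) k)).asHomogeneousIdeal} \ {((vanishingIdeal (⟨closure (Set.range ι), isClosed_closure⟩ : Closeds (projectiveSpace 3 k).left)).subschemeι x₀ : (projectiveSpace 3 k).left)}))) hZ).isClosedEmbedding.injective (h.trans hz'.symm)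
      rw [h1]; exact hzc.preimage (redSubι F₂ ((υ ⁻¹' {((vanishingIdeal (⟨closure (Set.range ι), isClosed_closure⟩ : Closeds (projectiveSpace 3 k).left)).subschemeι x₀ : (projectiveSpace 3 k).left)}) ∩ closure (υ ⁻¹' ({y : (projectiveSpace 3 k).left | ℓh ∈ (y : ProjectiveSpectrum (homogeneousSubmodule (Fin (3 + 1)) k)).asHomogeneousIdeal} \ {((vanishingIdeal (⟨closure (Set.range ι), isClosed_closure⟩ : Closeds (projectiveSpace 3 k).left)).subschemeι x₀ : (projectiveSpace 3 k).left)}))) hZ).continuous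
    have h1 : ringKrullDim (F₂.presheaf.stalk z ⧸ stalkIdeal (vanishingIdeal (⟨((υ ⁻¹' {((vanishingIdeal (⟨closure (Set.range ι), isClosed_closure⟩ : Closeds (projectiveSpace 3 k).left)).subschemeι x₀ : (projectiveSpace 3 k).left)}) ∩ closure (υ ⁻¹' ({y : (projectiveSpace 3 k).left | ℓh ∈ (y : ProjectiveSpectrum (homogeneousSubmodule (Fin (3 + 1)) k)).asHomogeneousIdeal} \ {((vanishingIdeal (⟨closure (Set.range ι), isClosed_closure⟩ : Closeds (projectiveSpace 3 k).left)).subschemeι x₀ : (projectiveSpace 3 k).left)}))), hZ⟩ : Closeds F₂)) z) = ((1 : ℕ) : WithBot ℕ∞) := by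
      rw [← hz', ← Literature.AlgebraicGeometry.Resolution.ringKrullDim_stalk_subscheme]; exact hZdim z' hzc'
    have hjc : IsClosed ({j₂ z} : Set X₁) := by
      have := j₂.isClosedMap _ hzc; rwa [Set.image_singleton] at this
    have hjs : ((τ ≫ 𝟙 (Proj (homogeneousSubmodule (Fin (3 + 1)) O))) ≫ (Proj.toSpecZero (homogeneousSubmodule (Fin (3 + 1)) O) ≫ Spec.map (CommRingCat.ofHom (algebraMap O (homogeneousSubmodule (Fin (3 + 1)) O 0))))).base (j₂ z) = closedPoint O := by
      have h2 : j₂ z ∈ Set.range j₂ := ⟨z, rfl⟩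
      rw [range_eq_preimage_of_isPullback hsq₂, range_specMap_of_surjective_of_field θ hθ] at h2
      exact h2
    have h4 : ringKrullDim (X₁.presheaf.stalk (j₂ z)) = ((3 + 1 : ℕ) : WithBot ℕ∞) :=
      ringKrullDim_stalk_eq_succ_of_chain (Proj.toSpecZero (homogeneousSubmodule (Fin (3 + 1)) O) ≫ Spec.map (CommRingCat.ofHom (algebraMap O (homogeneousSubmodule (Fin (3 + 1)) O 0)))) 3 hξ hch₁ hjc hjs
    haveI : Flat ((τ ≫ 𝟙 (Proj (homogeneousSubmodule (Fin (3 + 1)) O))) ≫ (Proj.toSpecZero (homogeneousSubmodule (Fin (3 + 1)) O) ≫ Spec.map (CommRingCat.ofHom (algebraMap O (homogeneousSubmodule (Fin (3 + 1)) O 0))))) := flat_of_isIntegral_of_isDominant _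
    obtain ⟨-, hd⟩ := ND.goodAt_and_dim_of_model O k θ hθ ((τ ≫ 𝟙 (Proj (homogeneousSubmodule (Fin (3 + 1)) O))) ≫ (Proj.toSpecZero (homogeneousSubmodule (Fin (3 + 1)) O) ≫ Spec.map (CommRingCat.ofHom (algebraMap O (homogeneousSubmodule (Fin (3 + 1)) O 0))))) j₂ t₂ hsq₂ z (hreg₁ _) (hFZreg z hz hzc)
    have h3 : ringKrullDim (F₂.presheaf.stalk z) = ((3 : ℕ) : WithBot ℕ∞) := withBot_enat_succ_cancel (by rw [← hd, h4])
    rw [h1, h3]; rfl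
  obtain ⟨hM2', hM5', hM0', hM4', hM1'⟩ := preLetterClauses_strictTransform_of_curveRound O (τ ≫ 𝟙 (Proj (homogeneousSubmodule (Fin (3 + 1)) O))) (Set.range (ι ≫ Proj.map φ hφ' : H ⟶ Proj (homogeneousSubmodule (Fin (3 + 1)) O))) (Proj.toSpecZero (homogeneousSubmodule (Fin (3 + 1)) O) ≫ Spec.map (CommRingCat.ofHom (algebraMap O (homogeneousSubmodule (Fin (3 + 1)) O 0)))) hreg₁ j₂
    (s.ker.comap τ ⊔ strictTransformIdeal τ s.ker (𝓛 ℓh)) hZ hCj hCreg hC0 hfr hτ₃ hυ' j₃ hcomm₃ hZreg hFZreg hcodim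
    (strictTransformIdeal τ s.ker 𝓜) hS0 hS2 hS5 hS4 (closure (υ ⁻¹' ({y : (projectiveSpace 3 k).left | G ∈ (y : ProjectiveSpectrum (homogeneousSubmodule (Fin (3 + 1)) k)).asHomogeneousIdeal} \ {((vanishingIdeal (⟨closure (Set.range ι), isClosed_closure⟩ : Closeds (projectiveSpace 3 k).left)).subschemeι x₀ : (projectiveSpace 3 k).left)}))) isClosed_closure hS1c 1 hord hgen'
  -- THE TAG: (IN-3) G1-CAR
  obtain ⟨⟨hQ1, hQ2, hQ3, hQ4, hQ5⟩, -⟩ := hLt ℓj (by simp)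
  have htag : strictTransformIdeal τ₃ (s.ker.comap τ ⊔ strictTransformIdeal τ s.ker (𝓛 ℓh)) (strictTransformIdeal τ s.ker 𝓜) ≤ (s.ker.comap τ ⊔ strictTransformIdeal τ s.ker (𝓛 ℓh)).comap τ₃ ⊔
        strictTransformIdeal τ₃ (s.ker.comap τ ⊔ strictTransformIdeal τ s.ker (𝓛 ℓh)) (strictTransformIdeal τ s.ker (𝓛 ℓj)) :=
    hG1C O θ hθ (τ ≫ 𝟙 (Proj (homogeneousSubmodule (Fin (3 + 1)) O))) (Set.range (ι ≫ Proj.map φ hφ' : H ⟶ Proj (homogeneousSubmodule (Fin (3 + 1)) O))) (Proj.toSpecZero (homogeneousSubmodule (Fin (3 + 1)) O) ≫ Spec.map (CommRingCat.ofHom (algebraMap O (homogeneousSubmodule (Fin (3 + 1)) O 0)))) hreg₁ j₂ t₂ hsq₂ (s.ker.comap τ) (strictTransformIdeal τ s.ker (𝓛 ℓh)) (strictTransformIdeal τ s.ker (𝓛 ℓj))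
      (strictTransformIdeal τ s.ker 𝓜) hZ hCj hCreg hC0 hfr hτ₃ hυ' j₃ hcomm₃ hZreg hFZreg hcodim hS2 hS0 (closure (υ ⁻¹' ({y : (projectiveSpace 3 k).left | G ∈ (y : ProjectiveSpectrum (homogeneousSubmodule (Fin (3 + 1)) k)).asHomogeneousIdeal} \ {((vanishingIdeal (⟨closure (Set.range ι), isClosed_closure⟩ : Closeds (projectiveSpace 3 k).left)).subschemeι x₀ : (projectiveSpace 3 k).left)}))) isClosed_closure hS1c hgen' a ha hincS
  -- THE FACE LETTER and the other letters: (IN-4) crossed with the model `St' (St 𝓛 ℓ)`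
  have hCross : ∀ ℓ ∈ ℓj :: ℓs, ((strictTransformIdeal τ₃ (s.ker.comap τ ⊔ strictTransformIdeal τ s.ker (𝓛 ℓh)) (strictTransformIdeal τ s.ker (𝓛 ℓ))).comap j₃ =
          vanishingIdeal (⟨closure (closure (υ' ⁻¹' (closure (υ ⁻¹' ((fun (ℓ' : MvPolynomial (Fin (3 + 1)) k) => {y : (projectiveSpace 3 k).left | ℓ' ∈ (y : ProjectiveSpectrum (homogeneousSubmodule (Fin (3 + 1)) k)).asHomogeneousIdeal}) ℓ \ {((vanishingIdeal (⟨closure (Set.range ι), isClosed_closure⟩ : Closeds (projectiveSpace 3 k).left)).subschemeι x₀ : (projectiveSpace 3 k).left)})) \ ((υ ⁻¹' {((vanishingIdeal (⟨closure (Set.range ι), isClosed_closure⟩ : Closeds (projectiveSpace 3 k).left)).subschemeι x₀ : (projectiveSpace 3 k).left)}) ∩ closure (υ ⁻¹' ({y : (projectiveSpace 3 k).left | ℓh ∈ (y : ProjectiveSpectrum (homogeneousSubmodule (Fin (3 + 1)) k)).asHomogeneousIdeal} \ {((vanishingIdeal (⟨closure (Set.range ι), isClosed_closure⟩ : Closeds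 (projectiveSpace 3 k).left)).subschemeι x₀ : (projectiveSpace 3 k).left)})))))), isClosed_closure⟩ : Closeds F₃) ∧
        (∀ z : X₃, (stalkIdeal (strictTransformIdeal τ₃ (s.ker.comap τ ⊔ strictTransformIdeal τ s.ker (𝓛 ℓh)) (strictTransformIdeal τ s.ker (𝓛 ℓ))) z).IsPrincipal) ∧
        Scheme.IsRegular (strictTransformIdeal τ₃ (s.ker.comap τ ⊔ strictTransformIdeal τ s.ker (𝓛 ℓh)) (strictTransformIdeal τ s.ker (𝓛 ℓ))).subscheme ∧
        (τ₃ ≫ τ ≫ 𝟙 (Proj (homogeneousSubmodule (Fin (3 + 1)) O))) '' ((strictTransformIdeal τ₃ (s.ker.comap τ ⊔ strictTransformIdeal τ s.ker (𝓛 ℓh)) (strictTransformIdeal τ s.ker (𝓛 ℓ))).support : Set X₃) ⊆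
          {p | ¬ IsGenericPoint p (Set.range (ι ≫ Proj.map φ hφ' : H ⟶ Proj (homogeneousSubmodule (Fin (3 + 1)) O)))} ∧
        Flat ((strictTransformIdeal τ₃ (s.ker.comap τ ⊔ strictTransformIdeal τ s.ker (𝓛 ℓh)) (strictTransformIdeal τ s.ker (𝓛 ℓ))).subschemeι ≫ (τ₃ ≫ τ ≫ 𝟙 (Proj (homogeneousSubmodule (Fin (3 + 1)) O))) ≫ (Proj.toSpecZero (homogeneousSubmodule (Fin (3 + 1)) O) ≫ Spec.map (CommRingCat.ofHom (algebraMap O (homogeneousSubmodule (Fin (3 + 1)) O 0)))))) := by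
    intro ℓ hℓ
    obtain ⟨⟨hl1, hl2, hl3, hl4, hl5⟩, -⟩ := hLt ℓ (List.mem_cons_of_mem _ hℓ)
    obtain ⟨hc1, hc2⟩ := hothers ℓ hℓ
    have hl1' : (strictTransformIdeal τ s.ker (𝓛 ℓ)).comap j₂ = vanishingIdeal (⟨closure (υ ⁻¹' ((fun (ℓ' : MvPolynomial (Fin (3 + 1)) k) => {y : (projectiveSpace 3 k).left | ℓ' ∈ (y : ProjectiveSpectrum (homogeneousSubmodule (Fin (3 + 1)) k)).asHomogeneousIdeal}) ℓ \ {((vanishingIdeal (⟨closure (Set.range ι), isClosed_closure⟩ : Closeds (projectiveSpace 3 k).left)).subschemeι x₀ : (projectiveSpace 3 k).left)})), isClosed_closure⟩ : Closeds F₂) := by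
      rw [hl1]; congr 1; exact Closeds.ext closure_closure
    exact hCLw O θ hθ (Proj.toSpecZero (homogeneousSubmodule (Fin (3 + 1)) O) ≫ Spec.map (CommRingCat.ofHom (algebraMap O (homogeneousSubmodule (Fin (3 + 1)) O 0)))) (Set.range (ι ≫ Proj.map φ hφ' : H ⟶ Proj (homogeneousSubmodule (Fin (3 + 1)) O))) (τ ≫ 𝟙 (Proj (homogeneousSubmodule (Fin (3 + 1)) O))) hreg₁ hX₃r j₂ t₂ hsq₂ _ ((υ ⁻¹' {((vanishingIdeal (⟨closure (Set.range ι), isClosed_closure⟩ : Closeds (projectiveSpace 3 k).left)).subschemeι x₀ : (projectiveSpace 3 k).left)}) ∩ closure (υ ⁻¹' ((fun (ℓ' : MvPolynomial (Fin (3 + 1)) k) => {y : (projectiveSpace 3 k).left | ℓ' ∈ (y : ProjectiveSpectrum (homogeneousSubmodule (Fin (3 + 1)) k)).asHomogeneousIdeal}) ℓh \ {((vanishingIdeal (⟨closure (Set.range ι), isClosed_closure⟩ : Closeds (projectiveSpace 3 k).left)).subschemeι x₀ : (projectiveSpace 3 k).left)}))) hZ hCj hCfl hCreg hC0 hfr hoff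 hZreg hZdim hFZreg hτ₃ hυ' j₃ t₃ hsq₃ hcomm₃
      (υ ⁻¹' ((fun (ℓ' : MvPolynomial (Fin (3 + 1)) k) => {y : (projectiveSpace 3 k).left | ℓ' ∈ (y : ProjectiveSpectrum (homogeneousSubmodule (Fin (3 + 1)) k)).asHomogeneousIdeal}) ℓ \ {((vanishingIdeal (⟨closure (Set.range ι), isClosed_closure⟩ : Closeds (projectiveSpace 3 k).left)).subschemeι x₀ : (projectiveSpace 3 k).left)})) _ hl1' hl2 hl3 hl4 hl5 hc1 hc2
  -- THE NEW EXCEPTIONAL LETTER `E₁ = υ'⁻¹ Z` with the model `𝒞·𝒪_{X₃}` (as ✓ `TCPlus.excLetter_birth`, model kept)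
  have hsq₃' : IsPullback j₃ t₃ (τ₃ ≫ (τ ≫ 𝟙 (Proj (homogeneousSubmodule (Fin (3 + 1)) O))) ≫ (Proj.toSpecZero (homogeneousSubmodule (Fin (3 + 1)) O) ≫ Spec.map (CommRingCat.ofHom (algebraMap O (homogeneousSubmodule (Fin (3 + 1)) O 0))))) (Spec.map (CommRingCat.ofHom θ)) := by simpa only [Category.assoc] using hsq₃
  have hqr : ∀ z ∈ ((⟨((υ ⁻¹' {((vanishingIdeal (⟨closure (Set.range ι), isClosed_closure⟩ : Closeds (projectiveSpace 3 k).left)).subschemeι x₀ : (projectiveSpace 3 k).left)}) ∩ closure (υ ⁻¹' ({y : (projectiveSpace 3 k).left | ℓh ∈ (y : ProjectiveSpectrum (homogeneousSubmodule (Fin (3 + 1)) k)).asHomogeneousIdeal} \ {((vanishingIdeal (⟨closure (Set.range ι), isClosed_closure⟩ : Closeds (projectiveSpace 3 k).left)).subschemeι x₀ : (projectiveSpace 3 k).left)}))), hZ⟩ : Closeds F₂) : Set F₂), ∃ (n : ℕ) (c : Fin n → X₁.presheaf.stalk (j₂ z)),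
      Ideal.span (Set.range c) = stalkIdeal (s.ker.comap τ ⊔ strictTransformIdeal τ s.ker (𝓛 ℓh)) (j₂ z) ∧ IsQuasiRegular c := by
    intro z hz
    have hmem : j₂ z ∈ (s.ker.comap τ ⊔ strictTransformIdeal τ s.ker (𝓛 ℓh)).support := by
      have h1 : z ∈ (((s.ker.comap τ ⊔ strictTransformIdeal τ s.ker (𝓛 ℓh)).comap j₂).support : Set F₂) := by
        rw [hCj, Scheme.IdealSheafData.coe_support_vanishingIdeal]; exact hz
      rw [support_comap] at h1; exact h1
    obtain ⟨c, hc, hq⟩ := hfr _ hmem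
    exact ⟨2, c, hc, hq⟩
  have hX1 : ((s.ker.comap τ ⊔ strictTransformIdeal τ s.ker (𝓛 ℓh)).comap τ₃).comap j₃ = vanishingIdeal ⟨closure (υ' ⁻¹' ((υ ⁻¹' {((vanishingIdeal (⟨closure (Set.range ι), isClosed_closure⟩ : Closeds (projectiveSpace 3 k).left)).subschemeι x₀ : (projectiveSpace 3 k).left)}) ∩ closure (υ ⁻¹' ({y : (projectiveSpace 3 k).left | ℓh ∈ (y : ProjectiveSpectrum (homogeneousSubmodule (Fin (3 + 1)) k)).asHomogeneousIdeal} \ {((vanishingIdeal (⟨closure (Set.range ι), isClosed_closure⟩ : Closeds (projectiveSpace 3 k).left)).subschemeι x₀ : (projectiveSpace 3 k).left)})))), isClosed_closure⟩ := by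
    have h := comap_comap_eq_vanishingIdeal_preimage_of_model O k θ hθ ((τ ≫ 𝟙 (Proj (homogeneousSubmodule (Fin (3 + 1)) O))) ≫ (Proj.toSpecZero (homogeneousSubmodule (Fin (3 + 1)) O) ≫ Spec.map (CommRingCat.ofHom (algebraMap O (homogeneousSubmodule (Fin (3 + 1)) O 0))))) j₂ t₂ hsq₂ _ τ₃ hτ₃ j₃ t₃ hsq₃' υ' hcomm₃ ⟨((υ ⁻¹' {((vanishingIdeal (⟨closure (Set.range ι), isClosed_closure⟩ : Closeds (projectiveSpace 3 k).left)).subschemeι x₀ : (projectiveSpace 3 k).left)}) ∩ closure (υ ⁻¹' ({y : (projectiveSpace 3 k).left | ℓh ∈ (y : ProjectiveSpectrum (homogeneousSubmodule (Fin (3 + 1)) k)).asHomogeneousIdeal} \ {((vanishingIdeal (⟨closure (Set.range ι), isClosed_closure⟩ : Closeds (projectiveSpace 3 k).left)).subschemeι x₀ : (projectiveSpace 3 k).left)}))), hZ⟩ hCj hqr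
    rw [h]; congr 1; exact Closeds.ext (hZ.preimage υ'.continuous).closure_eq.symm
  have hX5 : Flat (((s.ker.comap τ ⊔ strictTransformIdeal τ s.ker (𝓛 ℓh)).comap τ₃).subschemeι ≫ (τ₃ ≫ τ ≫ 𝟙 (Proj (homogeneousSubmodule (Fin (3 + 1)) O))) ≫ (Proj.toSpecZero (homogeneousSubmodule (Fin (3 + 1)) O) ≫ Spec.map (CommRingCat.ofHom (algebraMap O (homogeneousSubmodule (Fin (3 + 1)) O 0))))) := by
    have h := flat_exceptional_of_isBlowup_regularCentre O X₁ X₃ ((τ ≫ 𝟙 (Proj (homogeneousSubmodule (Fin (3 + 1)) O))) ≫ (Proj.toSpecZero (homogeneousSubmodule (Fin (3 + 1)) O) ≫ Spec.map (CommRingCat.ofHom (algebraMap O (homogeneousSubmodule (Fin (3 + 1)) O 0))))) _ hreg₁ hCreg hCfl τ₃ hτ₃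
    simpa only [Category.assoc] using h
  have hX4 : (τ₃ ≫ τ ≫ 𝟙 (Proj (homogeneousSubmodule (Fin (3 + 1)) O))) '' (((s.ker.comap τ ⊔ strictTransformIdeal τ s.ker (𝓛 ℓh)).comap τ₃).support : Set X₃) ⊆ {p | ¬ IsGenericPoint p (Set.range (ι ≫ Proj.map φ hφ' : H ⟶ Proj (homogeneousSubmodule (Fin (3 + 1)) O)))} :=
    image_support_comap_subset _ τ₃ (τ ≫ 𝟙 (Proj (homogeneousSubmodule (Fin (3 + 1)) O))) hoff
  -- PROMOTE the key letter: its model `St' St 𝓜` is regular (flat, proper, regular special fibre — ✓ p665751's argument with the model kept)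
  have hK1 : (strictTransformIdeal τ₃ (s.ker.comap τ ⊔ strictTransformIdeal τ s.ker (𝓛 ℓh)) (strictTransformIdeal τ s.ker 𝓜)).comap j₃ =
      vanishingIdeal ⟨closure (closure (υ' ⁻¹' (closure (υ ⁻¹' ({y : (projectiveSpace 3 k).left | G ∈ (y : ProjectiveSpectrum (homogeneousSubmodule (Fin (3 + 1)) k)).asHomogeneousIdeal} \ {((vanishingIdeal (⟨closure (Set.range ι), isClosed_closure⟩ : Closeds (projectiveSpace 3 k).left)).subschemeι x₀ : (projectiveSpace 3 k).left)})) \ ((υ ⁻¹' {((vanishingIdeal (⟨closure (Set.range ι), isClosed_closure⟩ : Closeds (projectiveSpace 3 k).left)).subschemeι x₀ : (projectiveSpace 3 k).left)}) ∩ closure (υ ⁻¹' ({y : (projectiveSpace 3 k).left | ℓh ∈ (y : ProjectiveSpectrum (homogeneousSubmodule (Fin (3 + 1)) k)).asHomogeneousIdeal} \ {((vanishingIdeal (⟨closure (Set.range ι), isClosed_closure⟩ : Closeds (projectiveSpace 3 k).left)).subschemeι x₀ : (projectiveSpace 3 k).left)})))))), isClosed_closure⟩ := by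
    rw [hM1']; congr 1; exact Closeds.ext closure_closure.symm
  obtain ⟨𝓚', hK'1, hK'2, hK'3, hK'4, hK'5⟩ := TCPlus.letterDatum_of_clauses_of_isRegular_redSub O k θ hθ (Proj.toSpecZero (homogeneousSubmodule (Fin (3 + 1)) O) ≫ Spec.map (CommRingCat.ofHom (algebraMap O (homogeneousSubmodule (Fin (3 + 1)) O 0)))) (Set.range (ι ≫ Proj.map φ hφ' : H ⟶ Proj (homogeneousSubmodule (Fin (3 + 1)) O))) (τ₃ ≫ τ ≫ 𝟙 (Proj (homogeneousSubmodule (Fin (3 + 1)) O))) j₃ t₃ hsq₃ _ hK1 hM2' hM4' hM5' hprom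
  have hKreg : Scheme.IsRegular (strictTransformIdeal τ₃ (s.ker.comap τ ⊔ strictTransformIdeal τ s.ker (𝓛 ℓh)) (strictTransformIdeal τ s.ker 𝓜)).subscheme := by
    -- the model square of `W = V(𝓛)` over `Spec θ` (✓ p665751 verbatim, model kept)
    let 𝓛K := strictTransformIdeal τ₃ (s.ker.comap τ ⊔ strictTransformIdeal τ s.ker (𝓛 ℓh)) (strictTransformIdeal τ s.ker 𝓜)
    let ιW := 𝓛K.subschemeι
    let iX := (𝓛K.comap j₃).subschemeι
    let jW : (𝓛K.comap j₃).subscheme ⟶ 𝓛K.subscheme := Scheme.IdealSheafData.subschemeMap (𝓛K.comap j₃) 𝓛K j₃ (𝓛K.le_map_comap j₃)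
    have hjW : jW ≫ ιW = iX ≫ j₃ := Scheme.IdealSheafData.subschemeMap_subschemeι _ _ _ _
    have hsq1 : IsPullback iX jW j₃ ιW := isPullback_of_isClosedImmersion iX ιW jW j₃ hjW.symm (by rw [Scheme.IdealSheafData.ker_subschemeι, Scheme.IdealSheafData.ker_subschemeι])
    have hsqW : IsPullback jW (iX ≫ t₃) (ιW ≫ (τ₃ ≫ τ ≫ 𝟙 (Proj (homogeneousSubmodule (Fin (3 + 1)) O))) ≫ (Proj.toSpecZero (homogeneousSubmodule (Fin (3 + 1)) O) ≫ Spec.map (CommRingCat.ofHom (algebraMap O (homogeneousSubmodule (Fin (3 + 1)) O 0))))) (Spec.map (CommRingCat.ofHom θ)) := hsq1.flip.paste_vert hsq₃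
    have hW₀ : Scheme.IsRegular (𝓛K.comap j₃).subscheme := by
      have key : ∀ I : F₃.IdealSheafData, I = vanishingIdeal (⟨closure (closure (υ' ⁻¹' (closure (υ ⁻¹' ({y : (projectiveSpace 3 k).left | G ∈ (y : ProjectiveSpectrum (homogeneousSubmodule (Fin (3 + 1)) k)).asHomogeneousIdeal} \ {((vanishingIdeal (⟨closure (Set.range ι), isClosed_closure⟩ : Closeds (projectiveSpace 3 k).left)).subschemeι x₀ : (projectiveSpace 3 k).left)})) \ ((υ ⁻¹' {((vanishingIdeal (⟨closure (Set.range ι), isClosed_closure⟩ : Closeds (projectiveSpace 3 k).left)).subschemeι x₀ : (projectiveSpace 3 k).left)}) ∩ closure (υ ⁻¹' ({y : (projectiveSpace 3 k).left | ℓh ∈ (y : ProjectiveSpectrum (homogeneousSubmodule (Fin (3 + 1)) k)).asHomogeneousIdeal} \ {((vanishingIdeal (⟨closure (Set.range ι), isClosed_closure⟩ : Closeds (projectiveSpace 3 k).left)).subschemeι x₀ : (projectiveSpace 3 k).left)})))))), isClosed_closure⟩ : Closeds F₃) →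
          Scheme.IsRegular I.subscheme := by
        intro I hI; subst hI; exact hprom
      exact key _ hK1
    haveI : Flat (ιW ≫ (τ₃ ≫ τ ≫ 𝟙 (Proj (homogeneousSubmodule (Fin (3 + 1)) O))) ≫ (Proj.toSpecZero (homogeneousSubmodule (Fin (3 + 1)) O) ≫ Spec.map (CommRingCat.ofHom (algebraMap O (homogeneousSubmodule (Fin (3 + 1)) O 0))))) := hM5'
    haveI : IsProper (ιW ≫ (τ₃ ≫ τ ≫ 𝟙 (Proj (homogeneousSubmodule (Fin (3 + 1)) O))) ≫ (Proj.toSpecZero (homogeneousSubmodule (Fin (3 + 1)) O) ≫ Spec.map (CommRingCat.ofHom (algebraMap O (homogeneousSubmodule (Fin (3 + 1)) O 0))))) := inferInstance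
    exact isRegular_of_flat_proper_of_isRegular_specialFibre θ hθ (ιW ≫ (τ₃ ≫ τ ≫ 𝟙 (Proj (homogeneousSubmodule (Fin (3 + 1)) O))) ≫ (Proj.toSpecZero (homogeneousSubmodule (Fin (3 + 1)) O) ≫ Spec.map (CommRingCat.ofHom (algebraMap O (homogeneousSubmodule (Fin (3 + 1)) O 0))))) jW (iX ≫ t₃) hsqW hW₀
  -- THE OUTPUT
  refine ⟨X₃, τ₃ ≫ τ ≫ 𝟙 (Proj (homogeneousSubmodule (Fin (3 + 1)) O)), _, j₃, t₃, hCh₃, hX₃i, hX₃n, hX₃r, hX₃dom, hsq₃, rfl, isClosed_closure, hirr₃, hF₃i, ?_, ?_⟩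
  · intro L hL
    rcases List.mem_append.mp (hLs₃ L hL) with h | h
    · obtain ⟨ℓ, hℓ, rfl⟩ := List.mem_map.mp h
      by_cases hℓh : ℓ = ℓh
      · subst hℓh; exact hLP
      · exact ⟨_, hCross ℓ ((List.mem_cons.mp hℓ).resolve_left hℓh)⟩
    · simp only [List.mem_cons, List.not_mem_nil, or_false] at h
      rcases h with rfl | rfl | rfl
      · exact hLE
      · exact ⟨_, hX1, isPrincipal_stalkIdeal_comap_of_isBlowup _ hτ₃, hτ₃.isRegular_subscheme_comap hreg₁ hCreg, hX4, hX5⟩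
      · exact ⟨𝓚', hK'1, hK'2, hK'3, hK'4, hK'5⟩
  · intro K A C hKAC
    simp only [Option.some.injEq, Prod.mk.injEq] at hKAC
    obtain ⟨rfl, rfl, rfl⟩ := hKAC
    exact ⟨_, _, _, ⟨hK1, hM2', hKreg, hM4', hM5'⟩, ⟨hX1, isPrincipal_stalkIdeal_comap_of_isBlowup _ hτ₃, hτ₃.isRegular_subscheme_comap hreg₁ hCreg, hX4, hX5⟩, hCross ℓj (by simp), htag⟩

end Summit.ResolutionOfSingularities.ResolutionOfSingularities.Cruxes.EquisingularLiftNat.Sections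

end
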